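import Summits.QuantumFields.YangMills.Theorems.BrascampLiebVacuum.Negative.FalseWithoutLocality
import Summits.QuantumFields.YangMills.Theorems.BrascampLiebVacuum.Negative.FalseWithoutLipschitz
import Summits.QuantumFields.YangMills.Theorems.BrascampLiebVacuum.Negative.FalseForFiniteGroups
import Summits.QuantumFields.YangMills.Theorems.BrascampLiebVacuum.Negative.FalseOfSliceBottleneck
import Literature.MathematicalPhysics.QuantumLattice.GaugeGroupsProofs
import Literature.MathematicalPhysics.QuantumFieldTheory.SliceBottleneckCriterion
import Literature.AlgebraicTopology.FundamentalGroup.RotationGroupSO3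
import Literature.Probability.LatticeModels.TorusFourierProofs

/-!
# Disproof work file — crux `ConvexGribovBody.BrascampLiebVacuumSC` (stmt-QuantumFields-16404)

Standing disprover (cdisprove, cycle 1, 2026-08-16) of the RESTATED crux K1 of route
`ConvexGribovBody`: `BrascampLiebVacuumSC` = the old `BrascampLiebVacuum` (stmt-8779) with
`SimplyConnectedSpace G →` inserted and `∃ C` moved after `∀ β ≥ β₀`:

  `∀ G admissible, IsCompactSimpleLieGroup G → SimplyConnectedSpace G → ∀ r, ∃ β₀, ∀ β ≥ β₀,
   ∃ C > 0, ∃ S₀, ∀ S ≥ S₀, ∀ f (i) gauge-invariant (ii) time-zero-local (iii) link-Lipschitz,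
   Var_μ f ≤ C · Dmax(β, S) · dir f`.

This file INHERITS `Cruxes/BrascampLiebVacuum/Disproof.lean` (findings F0–F4 there) and the landed
negative lane `Theorems/BrascampLiebVacuum/Negative/*` (imported above), and records what changes
for the restated crux. Prose only in docstrings / comments; `sorry` only in `NearMisses`.

## Findings (index)

* **G0 — verdict so far: NO KILL.** Negation game: `∀ β₀ ∃ β ≥ β₀ ∀ C ∀ S₀ ∃ S ≥ S₀ ∃ admissible f`
  with `Var f > C · Dmax(β,S) · dir f`. With the landed `dmax_le_volume` (`Dmax ≤ 3N(2S+1)³`) a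
  kill needs, at a SIMPLY-CONNECTED admissible `(G, r)` and cofinally many `β`, admissible families
  with `Var/dir ≫ S³` (`brascampLiebVacuumSC_false_of_sliceBottleneckAt`, the only kill shape) —
  or a proof that `Dmax(β, S) → 0` along `S → ∞` (G3). Neither is available: for `π₁(G) = 0`
  the 't Hooft flux sectors are absent (vortex SHEETS cost `e^{−cβS²}`), bulk / Bhanot–Creutz
  first-order points of mixed-character actions `β · Re χ_r` sit at bounded `β` (dodged by
  `β₀(G, r)`), local traps are priced by `C(β)` (old F3 is moot for the per-β shape).
* **G1 — load-bearing hypotheses, re-certified for the SC shape (sorry-free, section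
  `LoadBearing`).** (ii) locality and (iii) Lipschitz stay NECESSARY at every admissible `(G, r)`
  — simply connected or not, whatever `β₀, C(β), S₀(β)`: the tree witnesses
  (`brascampLiebVacuum_false_without_locality_at`, `…_without_lipschitz_at`) are per
  `(C, β, S ≥ 1)` and re-package under the new quantifier prefix
  (`brascampLiebVacuumSC_false_without_locality`, `…_without_lipschitz`). The packaged
  `¬ (∀ G, … SimplyConnectedSpace G → …)` forms need ONE admissible simply-connected instance:
  `SU(2)` (`isCompactSimpleLieGroup_su2`, simplicity PROVED in the tree) and
  `simplyConnectedSpace_su2` PROVED HERE (section `SU2`: `S³ ≃ₜ SU(2)` by the quaternion matrix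
  map + the tree's `simplyConnectedSpace_sphere_quaternion`) — so all packaged negations are
  UNCONDITIONAL (`…'` versions), and `exists_admissible_simplyConnected` certifies that the
  crux's hypotheses are satisfiable (no vacuous truth). LANDED: `Negative/AdmissibleInstance.lean`
  (p124412 ACCEPTED), `Negative/LoadBearingHypotheses.lean` (proposed).
* **G2 — the new hypothesis `SimplyConnectedSpace G`.** (a) It makes the `ConnectedSpace` clause
  of `IsSimpleCompactGroup` REDUNDANT (`connectedSpace_of_simplyConnectedSpace`) and by itself
  excludes the discrete/finite junk witness of the old F2 (`not_discreteTopology_of_simplyConnected`: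
  a simply connected group with `≥ 2` elements is not discrete). (b) Dropping it gives exactly the
  old disprover's `BrascampLiebVacuumPerBeta`, false modulo `SliceBottleneck`
  (`brascampLiebVacuumSC_false_without_SC_of_sliceBottleneck`) — so SC is load-bearing modulo the
  light-flux input for `SO(3)`. (c) Kill shape for the crux itself:
  `brascampLiebVacuumSC_false_of_sliceBottleneckAt` — a slice bottleneck AT a simply-connected
  admissible `(G, r)`; no candidate mechanism (see G0 and `Findings-ideator1.md` S4).
* **G3 — the normalisation `Dmax` is load-bearing: the crux FORCES a volume-uniform floor
  `Dmax(β, S) ≥ c(β) > 0`** (sections `Floor`, `FloorProofs`; ALL PROVED, standard axioms).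
  `plaquette_variance_floor`: the t = 0 origin plaquette trace has `Var_μ ≥ e^{−2|β|B}·Var_Haar > 0`
  on EVERY torus `S ≥ 1` (one-link Haar floor + one-link locality of the Wilson action
  `|S(U) − S(U[e↦g])| ≤ B(r)` + `lmarginal`; no DLR needed); `dir_plaquette_le`: its Dirichlet form
  is `≤ 4(4N⁴)²`; hence `dmax_floor_of_brascampLiebVacuumSC` (crux ⇒ `∀ β ≥ β₀ ∃ c > 0 ∃ S₁ ∀ S ≥ S₁,
  Dmax(β,S) ≥ c`) and `brascampLiebVacuumSC_false_of_dmaxDegenerate'` (`liminf_S Dmax(β,S) = 0` for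
  cofinally many `β` at an SC admissible `(G,r)` ⇒ ¬crux). LANDED as `Negative/PlaquetteVarianceFloor`,
  `Negative/PlaquetteDirichletBound` (proposed p124869, p124888), `Negative/DmaxFloor` (to follow).
  The GZ scenario predicts `D(p) → 0` as `p → 0` (Zwanziger NPB 364 (1991) bounds only the
  zero-momentum MEAN field, `O(1/L)` per site, on the FMR), so the floor should sit at `|p| ≍ 1`;
  physically `avg_p D(p) ≥ 3 E[sup_h mean_ℓ ‖A^h_ℓ‖²_F] ≍ dim G / β` (Parseval), no degeneration
  is expected — but provers MUST prove the floor (it is a consequence of the crux).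
* **G5 — `Dmax` is GENUINE (anti-junk, section `Genuine`, all proved).** `measurable_iSup_argmin`
  (Berge: super-level sets of `x ↦ sup_{argmin F(x,·)} c(x,·)` are closed projections) ⇒
  `measurable_dmaxIntegrand` / integrability: `∫ (⨆ h, cov) ∂μ` is a real expectation, not Lean's
  junk `0` (had it been junk, `Dmax = 0` and the crux would be FALSE for the plaquette trace — a
  refuter's trap now closed); and `dmax_ge_parseval`: `Dmax ≥ L⁻³ E[sup_h Σ_{j,y} ‖A^h_j(y)‖²_F]`
  (the crux's phase is the conjugate `(ℤ/L)³` character, tree Plancherel), so the floor of G3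
  follows from `E[sup_h mean_ℓ ‖A^h_ℓ‖²_F] ≥ a(β) > 0` — pure minimal-Coulomb-gauge content.
* **G6 — sub-crux offered to planners (section `SubCrux`).** `CoulombGaugeAFloor r` (volume-
  uniform floor on `L⁻³ E[sup_h Σ‖A^h‖²_F]`, a property of the minimal lattice Coulomb gauge alone)
  and `dmax_floor_of_coulombGaugeAFloor` (it implies the `Dmax` floor that the crux needs, by
  Parseval). Necessary: `Dmax` floor (G3, proved); sufficient for it: `CoulombGaugeAFloor`.
* **G4 — quantifier census.** `∃ S₀(β)` is essentially redundant given `C(β)` (each fixed `(β, S)`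
  has a finite admissible Poincaré ratio and `Dmax(β,S) > 0`); `β₀(G, r)` is essential (strong
  coupling / bulk transitions); `C` before `β` = old item (trap-dead, unrefuted); `C` before `r`
  is not even typable (Dmax depends on `r`).
-/

noncomputable section

open scoped BigOperators Topology Matrix ENNReal Matrix.Norms.Frobenius ComplexConjugate
open Filter MeasureTheory Function
open Literature.MathematicalPhysics.QuantumFieldTheory
open Summit.QuantumFields.YangMills.Theorems.BrascampLiebVacuum.Negative

namespace Summit.QuantumFields.YangMills.Cruxes.BrascampLiebVacuumSC.Disproof

/-! ### Vocabulary: the crux body at `(G, r, β, C, S)` and its mutilations -/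

section Vocabulary

variable {G : Type} [Group G] [TopologicalSpace G] [IsTopologicalGroup G] [CompactSpace G]
  [MeasurableSpace G] [BorelSpace G]

/-- The crux's conclusion at fixed `(G, r, β, C, S)`: the Poincaré inequality for all admissible
`f` ((i) gauge invariant, (ii) time-zero local, (iii) link-Lipschitz) — VERBATIM the body of
`ConvexGribovBody.BrascampLiebVacuumSC` after `S₀ ≤ S →`. [folklore] -/
def BodyAt (r : LatticeRep G) (β C : ℝ) (S : ℕ) : Prop :=
  let μ := wilsonMeasure (d := 4) (L := 2 * S + 1) r.ρ β
  let fro : Matrix (Fin r.N) (Fin r.N) ℂ → ℝ := fun M => ∑ a, ∑ b, ‖M a b‖ ^ 2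
  let coul : GaugeConfig 4 (2 * S + 1) G → (Site 4 (2 * S + 1) → G) → ℝ := fun U h =>
    -∑ e : Edge 4 (2 * S + 1),
      (if e.1 0 = 0 ∧ e.2 ≠ 0 then (r.ρ (gaugeTransform h U e)).trace.re else 0)
  let cov : GaugeConfig 4 (2 * S + 1) G → (Site 4 (2 * S + 1) → G) →
      (Fin 3 → ZMod (2 * S + 1)) → ℝ := fun U h p =>
    (∑ j : Fin 3, fro (∑ y : Fin 3 → ZMod (2 * S + 1),
      Complex.exp (-(2 * Real.pi * Complex.I *
        (∑ i : Fin 3, ((p i).val : ℂ) * ((y i).val : ℂ)) / (2 * S + 1 : ℂ))) •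
      ((1 / 2 : ℂ) • (r.ρ (gaugeTransform h U (Fin.cons (0 : ZMod (2 * S + 1)) y, j.succ)) -
        (r.ρ (gaugeTransform h U (Fin.cons (0 : ZMod (2 * S + 1)) y, j.succ)))ᴴ)))) /
      ((2 * S + 1 : ℝ) ^ 3)
  let Dmax : ℝ := ⨆ p : Fin 3 → ZMod (2 * S + 1),
    ∫ U, (⨆ h : {h : Site 4 (2 * S + 1) → G // ∀ h', coul U h ≤ coul U h'}, cov U h.1 p) ∂μ
  let slope : (GaugeConfig 4 (2 * S + 1) G → ℝ) → GaugeConfig 4 (2 * S + 1) G →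
      Edge 4 (2 * S + 1) → ℝ := fun f U e =>
    Filter.limsup (fun g : G => |f (Function.update U e g) - f U| /
      Real.sqrt (fro (r.ρ g - r.ρ (U e)))) (𝓝[≠] (U e))
  let dir : (GaugeConfig 4 (2 * S + 1) G → ℝ) → ℝ := fun f =>
    ∑ e : Edge 4 (2 * S + 1), (if e.1 0 = 0 ∧ e.2 ≠ 0 then ∫ U, (slope f U e) ^ 2 ∂μ else 0)
  ∀ f : GaugeConfig 4 (2 * S + 1) G → ℝ, IsGaugeInvariant f →
    (∀ U V : GaugeConfig 4 (2 * S + 1) G,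
      (∀ e : Edge 4 (2 * S + 1), e.1 0 = 0 → e.2 ≠ 0 → U e = V e) → f U = f V) →
    (∃ K : ℝ, ∀ U V : GaugeConfig 4 (2 * S + 1) G,
      |f U - f V| ≤ K * ∑ e, Real.sqrt (fro (r.ρ (U e) - r.ρ (V e)))) →
    ∫ U, (f U - ∫ V, f V ∂μ) ^ 2 ∂μ ≤ C * Dmax * dir f

/-- The body with hypothesis (ii) (time-zero locality) deleted. [folklore] -/
def BodyNoLocAt (r : LatticeRep G) (β C : ℝ) (S : ℕ) : Prop :=
  let μ := wilsonMeasure (d := 4) (L := 2 * S + 1) r.ρ β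
  let fro : Matrix (Fin r.N) (Fin r.N) ℂ → ℝ := fun M => ∑ a, ∑ b, ‖M a b‖ ^ 2
  let coul : GaugeConfig 4 (2 * S + 1) G → (Site 4 (2 * S + 1) → G) → ℝ := fun U h =>
    -∑ e : Edge 4 (2 * S + 1),
      (if e.1 0 = 0 ∧ e.2 ≠ 0 then (r.ρ (gaugeTransform h U e)).trace.re else 0)
  let cov : GaugeConfig 4 (2 * S + 1) G → (Site 4 (2 * S + 1) → G) →
      (Fin 3 → ZMod (2 * S + 1)) → ℝ := fun U h p =>
    (∑ j : Fin 3, fro (∑ y : Fin 3 → ZMod (2 * S + 1),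
      Complex.exp (-(2 * Real.pi * Complex.I *
        (∑ i : Fin 3, ((p i).val : ℂ) * ((y i).val : ℂ)) / (2 * S + 1 : ℂ))) •
      ((1 / 2 : ℂ) • (r.ρ (gaugeTransform h U (Fin.cons (0 : ZMod (2 * S + 1)) y, j.succ)) -
        (r.ρ (gaugeTransform h U (Fin.cons (0 : ZMod (2 * S + 1)) y, j.succ)))ᴴ)))) /
      ((2 * S + 1 : ℝ) ^ 3)
  let Dmax : ℝ := ⨆ p : Fin 3 → ZMod (2 * S + 1),
    ∫ U, (⨆ h : {h : Site 4 (2 * S + 1) → G // ∀ h', coul U h ≤ coul U h'}, cov U h.1 p) ∂μ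
  let slope : (GaugeConfig 4 (2 * S + 1) G → ℝ) → GaugeConfig 4 (2 * S + 1) G →
      Edge 4 (2 * S + 1) → ℝ := fun f U e =>
    Filter.limsup (fun g : G => |f (Function.update U e g) - f U| /
      Real.sqrt (fro (r.ρ g - r.ρ (U e)))) (𝓝[≠] (U e))
  let dir : (GaugeConfig 4 (2 * S + 1) G → ℝ) → ℝ := fun f =>
    ∑ e : Edge 4 (2 * S + 1), (if e.1 0 = 0 ∧ e.2 ≠ 0 then ∫ U, (slope f U e) ^ 2 ∂μ else 0)
  ∀ f : GaugeConfig 4 (2 * S + 1) G → ℝ, IsGaugeInvariant f →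
    (∃ K : ℝ, ∀ U V : GaugeConfig 4 (2 * S + 1) G,
      |f U - f V| ≤ K * ∑ e, Real.sqrt (fro (r.ρ (U e) - r.ρ (V e)))) →
    ∫ U, (f U - ∫ V, f V ∂μ) ^ 2 ∂μ ≤ C * Dmax * dir f

/-- The body with hypothesis (iii) (link-Lipschitz) deleted. [folklore] -/
def BodyNoLipAt (r : LatticeRep G) (β C : ℝ) (S : ℕ) : Prop :=
  let μ := wilsonMeasure (d := 4) (L := 2 * S + 1) r.ρ β
  let fro : Matrix (Fin r.N) (Fin r.N) ℂ → ℝ := fun M => ∑ a, ∑ b, ‖M a b‖ ^ 2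
  let coul : GaugeConfig 4 (2 * S + 1) G → (Site 4 (2 * S + 1) → G) → ℝ := fun U h =>
    -∑ e : Edge 4 (2 * S + 1),
      (if e.1 0 = 0 ∧ e.2 ≠ 0 then (r.ρ (gaugeTransform h U e)).trace.re else 0)
  let cov : GaugeConfig 4 (2 * S + 1) G → (Site 4 (2 * S + 1) → G) →
      (Fin 3 → ZMod (2 * S + 1)) → ℝ := fun U h p =>
    (∑ j : Fin 3, fro (∑ y : Fin 3 → ZMod (2 * S + 1),
      Complex.exp (-(2 * Real.pi * Complex.I *
        (∑ i : Fin 3, ((p i).val : ℂ) * ((y i).val : ℂ)) / (2 * S + 1 : ℂ))) •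
      ((1 / 2 : ℂ) • (r.ρ (gaugeTransform h U (Fin.cons (0 : ZMod (2 * S + 1)) y, j.succ)) -
        (r.ρ (gaugeTransform h U (Fin.cons (0 : ZMod (2 * S + 1)) y, j.succ)))ᴴ)))) /
      ((2 * S + 1 : ℝ) ^ 3)
  let Dmax : ℝ := ⨆ p : Fin 3 → ZMod (2 * S + 1),
    ∫ U, (⨆ h : {h : Site 4 (2 * S + 1) → G // ∀ h', coul U h ≤ coul U h'}, cov U h.1 p) ∂μ
  let slope : (GaugeConfig 4 (2 * S + 1) G → ℝ) → GaugeConfig 4 (2 * S + 1) G →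
      Edge 4 (2 * S + 1) → ℝ := fun f U e =>
    Filter.limsup (fun g : G => |f (Function.update U e g) - f U| /
      Real.sqrt (fro (r.ρ g - r.ρ (U e)))) (𝓝[≠] (U e))
  let dir : (GaugeConfig 4 (2 * S + 1) G → ℝ) → ℝ := fun f =>
    ∑ e : Edge 4 (2 * S + 1), (if e.1 0 = 0 ∧ e.2 ≠ 0 then ∫ U, (slope f U e) ^ 2 ∂μ else 0)
  ∀ f : GaugeConfig 4 (2 * S + 1) G → ℝ, IsGaugeInvariant f →
    (∀ U V : GaugeConfig 4 (2 * S + 1) G,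
      (∀ e : Edge 4 (2 * S + 1), e.1 0 = 0 → e.2 ≠ 0 → U e = V e) → f U = f V) →
    ∫ U, (f U - ∫ V, f V ∂μ) ^ 2 ∂μ ≤ C * Dmax * dir f

/-- The crux's per-`(G, r)` quantifier prefix over a body. [folklore] -/
def PrefixSC (P : ℝ → ℝ → ℕ → Prop) : Prop :=
  ∃ β₀ : ℝ, ∀ β : ℝ, β₀ ≤ β → ∃ C : ℝ, 0 < C ∧ ∃ S₀ : ℕ, ∀ S : ℕ, S₀ ≤ S → P β C S

/-- **The crux, re-read through the vocabulary** (definitional: `Iff.rfl`). [folklore] -/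
theorem brascampLiebVacuumSC_iff :
    Summit.QuantumFields.YangMills.Theses.ConvexGribovBody.BrascampLiebVacuumSC ↔
      ∀ (G : Type) [Group G] [TopologicalSpace G] [IsTopologicalGroup G] [CompactSpace G]
        [MeasurableSpace G] [BorelSpace G], IsCompactSimpleLieGroup G → SimplyConnectedSpace G →
        ∀ r : LatticeRep G, PrefixSC (fun β C S => BodyAt r β C S) :=
  Iff.rfl

end Vocabulary

/-! ### G1 — hypotheses (ii) and (iii) remain load-bearing under the new quantifier prefix -/

section LoadBearing

variable {G : Type} [Group G] [TopologicalSpace G] [IsTopologicalGroup G] [CompactSpace G]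
  [MeasurableSpace G] [BorelSpace G]

/-- **(ii) is load-bearing for `BrascampLiebVacuumSC` at EVERY admissible `(G, r)`** (simply
connected or not): whatever `β₀`, `C(β)`, `S₀(β)` are offered, at `β = β₀`, `S = max S₀ 1` the
slice-ONE plaquette trace is gauge invariant and link-Lipschitz with `dir f = 0 < Var_μ f`
(tree: `brascampLiebVacuum_false_without_locality_at`). [folklore] -/
theorem brascampLiebVacuumSC_false_without_locality (hG : IsCompactSimpleLieGroup G)
    (r : LatticeRep G) : ¬ PrefixSC (fun β C S => BodyNoLocAt r β C S) := by
  rintro ⟨β₀, h⟩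
  obtain ⟨C, -, S₀, hS₀⟩ := h β₀ le_rfl
  have h1 := hS₀ (max S₀ 1) (le_max_left _ _)
  obtain ⟨f, hf₁, hf₃, -, hlt⟩ := brascampLiebVacuum_false_without_locality_at hG r C β₀
    (S := max S₀ 1) (le_max_right _ _)
  exact absurd (h1 f hf₁ hf₃) (not_le.2 hlt)

/-- **(iii) is load-bearing for `BrascampLiebVacuumSC` at EVERY admissible `(G, r)`**: the
indicator of `{Re tr ρ(U_p) < c}` (`p` the time-zero plaquette at the origin) is gauge invariant,
time-zero local, has all metric slopes `0` (junk `sInf ∅ = 0` at the jump set) and positive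
variance (tree: `brascampLiebVacuum_false_without_lipschitz_at`). [folklore] -/
theorem brascampLiebVacuumSC_false_without_lipschitz (hG : IsCompactSimpleLieGroup G)
    (r : LatticeRep G) : ¬ PrefixSC (fun β C S => BodyNoLipAt r β C S) := by
  rintro ⟨β₀, h⟩
  obtain ⟨C, -, S₀, hS₀⟩ := h β₀ le_rfl
  have h1 := hS₀ (max S₀ 1) (le_max_left _ _)
  obtain ⟨f, hf₁, hf₂, -, -, hlt⟩ := brascampLiebVacuum_false_without_lipschitz_at hG
    (S := max S₀ 1) (le_max_right _ _) r C β₀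
  exact absurd (h1 f hf₁ hf₂) (not_le.2 hlt)

/-- **`SU(2)` is an admissible gauge group** (tree: `isSimpleCompactGroup_specialUnitaryGroup_holds`,
PROVED; fundamental representation faithful unitary). [folklore] -/
theorem isCompactSimpleLieGroup_su2 : IsCompactSimpleLieGroup (Matrix.specialUnitaryGroup (Fin 2) ℂ) :=
  isCompactSimpleLieGroup_specialUnitaryGroup
    Literature.MathematicalPhysics.QuantumLattice.isSimpleCompactGroup_specialUnitaryGroup_holds le_rfl

/-- **The SC crux with (ii) deleted is false**, modulo `SimplyConnectedSpace SU(2)` (true —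
`SU(2) ≃ₜ S³` and the tree's `simplyConnectedSpace_sphere_quaternion`; the homeomorphism is not
yet in the tree), used only to exhibit ONE admissible simply-connected group. [folklore] -/
theorem not_brascampLiebVacuumSC_without_locality
    (hSC : SimplyConnectedSpace (Matrix.specialUnitaryGroup (Fin 2) ℂ)) :
    ¬ (∀ (G : Type) [Group G] [TopologicalSpace G] [IsTopologicalGroup G] [CompactSpace G]
        [MeasurableSpace G] [BorelSpace G], IsCompactSimpleLieGroup G → SimplyConnectedSpace G →
        ∀ r : LatticeRep G, PrefixSC (fun β C S => BodyNoLocAt r β C S)) := by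
  intro h
  obtain ⟨r⟩ := isCompactSimpleLieGroup_su2.2
  exact brascampLiebVacuumSC_false_without_locality isCompactSimpleLieGroup_su2 r
    (h _ isCompactSimpleLieGroup_su2 hSC r)

/-- **The SC crux with (iii) deleted is false**, modulo `SimplyConnectedSpace SU(2)` as above. [folklore] -/
theorem not_brascampLiebVacuumSC_without_lipschitz
    (hSC : SimplyConnectedSpace (Matrix.specialUnitaryGroup (Fin 2) ℂ)) :
    ¬ (∀ (G : Type) [Group G] [TopologicalSpace G] [IsTopologicalGroup G] [CompactSpace G]
        [MeasurableSpace G] [BorelSpace G], IsCompactSimpleLieGroup G → SimplyConnectedSpace G →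
        ∀ r : LatticeRep G, PrefixSC (fun β C S => BodyNoLipAt r β C S)) := by
  intro h
  obtain ⟨r⟩ := isCompactSimpleLieGroup_su2.2
  exact brascampLiebVacuumSC_false_without_lipschitz isCompactSimpleLieGroup_su2 r
    (h _ isCompactSimpleLieGroup_su2 hSC r)

end LoadBearing

/-! ### G2 — the new hypothesis `SimplyConnectedSpace G` -/

section SimplyConnected

/-- `SimplyConnectedSpace G` already forces `ConnectedSpace G`: the first clause of
`IsSimpleCompactGroup` is redundant in the SC crux. [folklore] -/
theorem connectedSpace_of_simplyConnectedSpace (X : Type*) [TopologicalSpace X]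
    [SimplyConnectedSpace X] : ConnectedSpace X := by
  infer_instance

/-- A simply connected space with two distinct points is not discrete: the finite/discrete junk
witness of the old F2 (`not_brascampLiebVacuum_for_finite_gauge_groups`) is excluded by the SC
hypothesis alone. [folklore] -/
theorem not_discreteTopology_of_simplyConnected (X : Type*) [TopologicalSpace X]
    [SimplyConnectedSpace X] {a b : X} (hab : a ≠ b) : ¬ DiscreteTopology X := by
  intro hX
  have hpre : IsPreconnected (Set.univ : Set X) := isPreconnected_univ
  have hsub := hpre.subsingleton
  exact hab (hsub (Set.mem_univ a) (Set.mem_univ b))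

variable {G : Type} [Group G] [TopologicalSpace G] [IsTopologicalGroup G] [CompactSpace G]
  [MeasurableSpace G] [BorelSpace G]

/-- **Kill shape for the SC crux**: a slice bottleneck AT a simply-connected admissible `(G, r)`
refutes it (composition with `dmax_le_volume`, exactly as `brascampLiebVacuum_false_of_sliceBottleneckAt`
but for the per-β prefix). No mechanism producing such a bottleneck for `π₁(G) = 0` is known
(module docstring G0). [folklore] -/
theorem brascampLiebVacuumSC_false_of_sliceBottleneckAt (hG : IsCompactSimpleLieGroup G)
    (hSC : SimplyConnectedSpace G) (r : LatticeRep G) (h : SliceBottleneckAt G r) :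
    ¬ Summit.QuantumFields.YangMills.Theses.ConvexGribovBody.BrascampLiebVacuumSC := by
  intro hBL
  obtain ⟨β₀, hβ⟩ := hBL G hG hSC r
  obtain ⟨β, hβ₀, hK⟩ := h β₀
  obtain ⟨C, hC, S₀, hS₀⟩ := hβ β hβ₀
  obtain ⟨S, hS, f, hf₁, hf₂, hf₃, hlt⟩ := hK (C * (3 * (r.N : ℝ))) S₀
  have hle := hS₀ S hS f hf₁ hf₂ hf₃
  have hD : _ ≤ 3 * (r.N : ℝ) * (2 * S + 1 : ℝ) ^ 3 := dmax_le_volume r β S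
  refine false_of_bounds hC ?_ hle hD hlt
  refine Finset.sum_nonneg fun e _ => ?_
  split_ifs
  · exact integral_nonneg fun U => sq_nonneg _
  · exact le_rfl

/-- **`SimplyConnectedSpace G` is load-bearing (modulo `SliceBottleneck`)**: the SC crux with that
hypothesis deleted — i.e. the old disprover's `BrascampLiebVacuumPerBeta`, `∀` compact simple `G` —
is false as soon as some admissible `(G, r)` carries a slice bottleneck (expected: `SO(3)`, light
't Hooft fluxes; `Literature.MathematicalPhysics.QuantumFieldTheory.SliceBottleneck`, open). [folklore] -/
theorem brascampLiebVacuumSC_false_without_SC_of_sliceBottleneck (h : SliceBottleneck) :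
    ¬ (∀ (G : Type) [Group G] [TopologicalSpace G] [IsTopologicalGroup G] [CompactSpace G]
        [MeasurableSpace G] [BorelSpace G], IsCompactSimpleLieGroup G →
        ∀ r : LatticeRep G, PrefixSC (fun β C S => BodyAt r β C S)) := by
  intro hPB
  obtain ⟨w⟩ := h
  letI := w.grp; letI := w.top; letI := w.topGrp; letI := w.cpt; letI := w.meas; letI := w.borel
  obtain ⟨β₀, hβ⟩ := hPB w.G w.simple w.r
  obtain ⟨β, hβ₀, hK⟩ := w.bottleneck β₀
  obtain ⟨C, hC, S₀, hS₀⟩ := hβ β hβ₀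
  obtain ⟨S, hS, f, hf₁, hf₂, hf₃, hlt⟩ := hK (C * (3 * (w.r.N : ℝ))) S₀
  have hle := hS₀ S hS f hf₁ hf₂ hf₃
  have hD : _ ≤ 3 * (w.r.N : ℝ) * (2 * S + 1 : ℝ) ^ 3 := dmax_le_volume w.r β S
  refine false_of_bounds hC ?_ hle hD hlt
  refine Finset.sum_nonneg fun e _ => ?_
  split_ifs
  · exact integral_nonneg fun U => sq_nonneg _
  · exact le_rfl

/-- The old `∀ G` item implies the SC crux (one line; also landed by a prover as
`brascampLiebVacuumSC_of_brascampLiebVacuum`). Recorded to fix the direction of all inherited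
negatives: refuting the SC crux refutes the old item, not conversely. [folklore] -/
theorem sc_of_old (h : Summit.QuantumFields.YangMills.Theses.ConvexGribovBody.BrascampLiebVacuum) :
    Summit.QuantumFields.YangMills.Theses.ConvexGribovBody.BrascampLiebVacuumSC := by
  intro G _ _ _ _ _ _ hG _ r
  obtain ⟨C, hC, β₀, hβ⟩ := h G hG r
  exact ⟨β₀, fun β hb => ⟨C, hC, hβ β hb⟩⟩

end SimplyConnected

/-! ### G3 — the covariance normalisation is load-bearing: the crux forces a floor on `Dmax` -/

section Floor

variable {G : Type} [Group G] [TopologicalSpace G] [IsTopologicalGroup G] [CompactSpace G]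
  [MeasurableSpace G] [BorelSpace G]

/-- The crux's covariance scale `Dmax(β, S)` at `(G, r)` (verbatim sub-expression). [folklore] -/
def dmax (r : LatticeRep G) (β : ℝ) (S : ℕ) : ℝ :=
  let μ := wilsonMeasure (d := 4) (L := 2 * S + 1) r.ρ β
  let fro : Matrix (Fin r.N) (Fin r.N) ℂ → ℝ := fun M => ∑ a, ∑ b, ‖M a b‖ ^ 2
  let coul : GaugeConfig 4 (2 * S + 1) G → (Site 4 (2 * S + 1) → G) → ℝ := fun U h =>
    -∑ e : Edge 4 (2 * S + 1),
      (if e.1 0 = 0 ∧ e.2 ≠ 0 then (r.ρ (gaugeTransform h U e)).trace.re else 0)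
  let cov : GaugeConfig 4 (2 * S + 1) G → (Site 4 (2 * S + 1) → G) →
      (Fin 3 → ZMod (2 * S + 1)) → ℝ := fun U h p =>
    (∑ j : Fin 3, fro (∑ y : Fin 3 → ZMod (2 * S + 1),
      Complex.exp (-(2 * Real.pi * Complex.I *
        (∑ i : Fin 3, ((p i).val : ℂ) * ((y i).val : ℂ)) / (2 * S + 1 : ℂ))) •
      ((1 / 2 : ℂ) • (r.ρ (gaugeTransform h U (Fin.cons (0 : ZMod (2 * S + 1)) y, j.succ)) -
        (r.ρ (gaugeTransform h U (Fin.cons (0 : ZMod (2 * S + 1)) y, j.succ)))ᴴ)))) /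
      ((2 * S + 1 : ℝ) ^ 3)
  ⨆ p : Fin 3 → ZMod (2 * S + 1),
    ∫ U, (⨆ h : {h : Site 4 (2 * S + 1) → G // ∀ h', coul U h ≤ coul U h'}, cov U h.1 p) ∂μ

/-- The crux's Dirichlet form `dir f` at `(G, r, β, S)` (verbatim sub-expression). [folklore] -/
def dirForm (r : LatticeRep G) (β : ℝ) (S : ℕ) (f : GaugeConfig 4 (2 * S + 1) G → ℝ) : ℝ :=
  let μ := wilsonMeasure (d := 4) (L := 2 * S + 1) r.ρ β
  let fro : Matrix (Fin r.N) (Fin r.N) ℂ → ℝ := fun M => ∑ a, ∑ b, ‖M a b‖ ^ 2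
  let slope : (GaugeConfig 4 (2 * S + 1) G → ℝ) → GaugeConfig 4 (2 * S + 1) G →
      Edge 4 (2 * S + 1) → ℝ := fun f U e =>
    Filter.limsup (fun g : G => |f (Function.update U e g) - f U| /
      Real.sqrt (fro (r.ρ g - r.ρ (U e)))) (𝓝[≠] (U e))
  ∑ e : Edge 4 (2 * S + 1), (if e.1 0 = 0 ∧ e.2 ≠ 0 then ∫ U, (slope f U e) ^ 2 ∂μ else 0)

/-- The variance of `f` under the torus Wilson measure (verbatim sub-expression). [folklore] -/
def var (r : LatticeRep G) (β : ℝ) (S : ℕ) (f : GaugeConfig 4 (2 * S + 1) G → ℝ) : ℝ :=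
  let μ := wilsonMeasure (d := 4) (L := 2 * S + 1) r.ρ β
  ∫ U, (f U - ∫ V, f V ∂μ) ^ 2 ∂μ

/-- `BodyAt` unfolded through `dmax`, `dirForm`, `var` (definitional). [folklore] -/
theorem bodyAt_iff (r : LatticeRep G) (β C : ℝ) (S : ℕ) :
    BodyAt r β C S ↔ ∀ f : GaugeConfig 4 (2 * S + 1) G → ℝ, IsGaugeInvariant f →
      (∀ U V : GaugeConfig 4 (2 * S + 1) G,
        (∀ e : Edge 4 (2 * S + 1), e.1 0 = 0 → e.2 ≠ 0 → U e = V e) → f U = f V) →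
      (∃ K : ℝ, ∀ U V : GaugeConfig 4 (2 * S + 1) G,
        |f U - f V| ≤ K * ∑ e, Real.sqrt (∑ a, ∑ b, ‖(r.ρ (U e) - r.ρ (V e)) a b‖ ^ 2)) →
      var r β S f ≤ C * dmax r β S * dirForm r β S f :=
  Iff.rfl

/-- **A uniform admissible probe**: at `(G, r)` there is, on every torus `S ≥ 1`, an admissible
test function whose Dirichlet form is bounded by `k` and whose variance is at least `v(β) > 0`,
UNIFORMLY in `S`. (Intended witness: the time-zero plaquette trace `Re tr ρ(U_p)`: `dir ≤ 4·(4N⁴)²`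
since only its four links have non-zero slopes `≤` the Lipschitz constant; `Var ≥ e^{−O(βN)} ·
Var_Haar(Re χ_r)` by the DLR structure of Wilson's measure and the one-link Haar variance — TRUE,
formalisation pending: needs `isGibbsMeasure_wilsonMeasure` + law of total variance.) [folklore] -/
def PlaquetteVarianceFloor (r : LatticeRep G) : Prop :=
  ∃ k : ℝ, ∀ β : ℝ, ∃ v : ℝ, 0 < v ∧ ∀ S : ℕ, 1 ≤ S →
    ∃ f : GaugeConfig 4 (2 * S + 1) G → ℝ, IsGaugeInvariant f ∧
      (∀ U V : GaugeConfig 4 (2 * S + 1) G,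
        (∀ e : Edge 4 (2 * S + 1), e.1 0 = 0 → e.2 ≠ 0 → U e = V e) → f U = f V) ∧
      (∃ K : ℝ, ∀ U V : GaugeConfig 4 (2 * S + 1) G,
        |f U - f V| ≤ K * ∑ e, Real.sqrt (∑ a, ∑ b, ‖(r.ρ (U e) - r.ρ (V e)) a b‖ ^ 2)) ∧
      dirForm r β S f ≤ k ∧ v ≤ var r β S f

/-- **Degeneration of the covariance scale** at `(G, r)`: for cofinally many `β`,
`liminf_{S → ∞} Dmax(β, S) = 0`. [folklore] -/
def DmaxDegenerate (r : LatticeRep G) : Prop :=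
  ∀ β₀ : ℝ, ∃ β : ℝ, β₀ ≤ β ∧ ∀ c : ℝ, 0 < c → ∀ S₀ : ℕ, ∃ S : ℕ, S₀ ≤ S ∧ dmax r β S < c

/-- `dir f ≥ 0` (finite sum of integrals of squares). [folklore] -/
theorem dirForm_nonneg (r : LatticeRep G) (β : ℝ) (S : ℕ) (f : GaugeConfig 4 (2 * S + 1) G → ℝ) :
    0 ≤ dirForm r β S f := by
  refine Finset.sum_nonneg fun e _ => ?_
  split_ifs
  · exact integral_nonneg fun U => sq_nonneg _
  · exact le_rfl

/-- **The crux at `(G, r)` forces a volume-uniform floor on `Dmax`** (per-`(G, r)` form): if the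
per-β prefix of the crux holds at `(G, r)` and `(G, r)` carries a uniform admissible probe, then
for every `β ≥ β₀` there is `c > 0` with `Dmax(β, S) ≥ c` on all tori `S ≥ max S₀ 1`
(`c = v(β) / (C(β) · k)`). [folklore] -/
theorem dmax_floor_of_prefixSC (r : LatticeRep G) (hP : PlaquetteVarianceFloor r)
    (h : PrefixSC (fun β C S => BodyAt r β C S)) :
    ∃ β₀ : ℝ, ∀ β : ℝ, β₀ ≤ β → ∃ c : ℝ, 0 < c ∧ ∃ S₀ : ℕ, ∀ S : ℕ, S₀ ≤ S → c ≤ dmax r β S := by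
  obtain ⟨k, hk⟩ := hP
  obtain ⟨β₀, hβ⟩ := h
  refine ⟨β₀, fun β hb => ?_⟩
  obtain ⟨C, hC, S₀, hS₀⟩ := hβ β hb
  obtain ⟨v, hv, hvS⟩ := hk β
  have hk0 : 0 < max k 1 := lt_of_lt_of_le one_pos (le_max_right _ _)
  refine ⟨v / (C * max k 1), div_pos hv (mul_pos hC hk0), max S₀ 1, fun S hS => ?_⟩
  obtain ⟨f, hf₁, hf₂, hf₃, hdir, hvar⟩ := hvS S (le_trans (le_max_right _ _) hS)
  have hbody := (bodyAt_iff r β C S).1 (hS₀ S (le_trans (le_max_left _ _) hS)) f hf₁ hf₂ hf₃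
  -- v ≤ var ≤ C * dmax * dir ≤ C * dmax * max k 1  (needs 0 ≤ dmax, which follows)
  have hd0 : 0 ≤ dirForm r β S f := dirForm_nonneg r β S f
  have hvle : v ≤ C * dmax r β S * dirForm r β S f := hvar.trans hbody
  -- if dmax < 0 the right-hand side is ≤ 0 < v, contradiction; so we may bound
  by_contra hlt
  have hdm : dmax r β S < v / (C * max k 1) := not_le.1 hlt
  rcases le_or_gt 0 (dmax r β S) with hD | hD
  · have h1 : C * dmax r β S * dirForm r β S f ≤ C * dmax r β S * max k 1 :=
      mul_le_mul_of_nonneg_left (hdir.trans (le_max_left _ _)) (mul_nonneg hC.le hD)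
    have h2 : C * dmax r β S * max k 1 < C * (v / (C * max k 1)) * max k 1 := by
      have := mul_lt_mul_of_pos_left hdm hC
      exact mul_lt_mul_of_pos_right this hk0
    have h3 : C * (v / (C * max k 1)) * max k 1 = v := by
      field_simp
    linarith
  · have h1 : C * dmax r β S * dirForm r β S f ≤ 0 :=
      mul_nonpos_of_nonpos_of_nonneg (mul_nonpos_of_nonneg_of_nonpos hC.le hD.le) hd0
    linarith

/-- **G3 as a negative lemma: the SC crux is false if, at some simply-connected admissible
`(G, r)` carrying a uniform admissible probe, the covariance scale degenerates.** Hence any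
proof of the crux contains a proof of `inf_{S ≥ S₀} Dmax(β, S) > 0` at every SC admissible
`(G, r)` and every large `β` — the refuter's "hidden requirement", kernel-checked modulo the
(true, unformalised) variance floor. [folklore] -/
theorem brascampLiebVacuumSC_false_of_dmaxDegenerate (hG : IsCompactSimpleLieGroup G)
    (hSC : SimplyConnectedSpace G) (r : LatticeRep G) (hP : PlaquetteVarianceFloor r)
    (hD : DmaxDegenerate r) :
    ¬ Summit.QuantumFields.YangMills.Theses.ConvexGribovBody.BrascampLiebVacuumSC := by
  intro hBL
  have h := (brascampLiebVacuumSC_iff.1 hBL) G hG hSC r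
  obtain ⟨β₀, hβ⟩ := dmax_floor_of_prefixSC r hP h
  obtain ⟨β, hb, hdeg⟩ := hD β₀
  obtain ⟨c, hc, S₀, hS₀⟩ := hβ β hb
  obtain ⟨S, hS, hlt⟩ := hdeg c hc S₀
  exact absurd (hS₀ S hS) (not_le.2 hlt)

end Floor

/-! ### G3 made unconditional in its variance hypothesis: the floor proofs
(landed as `Theorems/BrascampLiebVacuumSC/Negative/{PlaquetteVarianceFloor, PlaquetteDirichletBound,
DmaxFloor}.lean`; copies here keep the work file stand-alone) -/

section FloorProofs


variable {G : Type*} [Group G] [TopologicalSpace G] [IsTopologicalGroup G] [CompactSpace G]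
  [MeasurableSpace G] [BorelSpace G]

omit [Group G] [IsTopologicalGroup G] in
/-- Integrability of a continuous real function on the compact group. -/
theorem integrable_of_continuous {φ : G → ℝ} (hφ : Continuous φ) (μ : Measure G) [IsFiniteMeasure μ] :
    Integrable φ μ :=
  hφ.integrable_of_hasCompactSupport (HasCompactSupport.of_compactSpace _)

/-- **Uniform one-link variance floor**: for a faithful unitary `r` of a compact simple `G` there is
`σ > 0` with `σ ≤ ∫ (Re tr ρ(a g) − m)² dg` for every constant `m` and every `a`. -/
theorem exists_haar_sq_sub_ge (hG : IsCompactSimpleLieGroup G) (r : LatticeRep G) :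
    ∃ σ : ℝ, 0 < σ ∧ ∀ (m : ℝ) (a : G),
      σ ≤ ∫ g, ((r.ρ (a * g)).trace.re - m) ^ 2 ∂haarProbability G := by
  set χ : G → ℝ := fun g => (r.ρ g).trace.re with hχ
  have hχc : Continuous χ := continuous_trace_re r.ρ r.continuous
  set cbar : ℝ := ∫ g, χ g ∂haarProbability G with hcbar
  refine ⟨∫ g, (χ g - cbar) ^ 2 ∂haarProbability G, ?_, fun m a => ?_⟩
  · obtain ⟨a, ha⟩ := exists_re_trace_lt hG r
    have hne : χ 1 ≠ χ a := by
      simp only [hχ, map_one, Matrix.trace_one, Fintype.card_fin, Complex.natCast_re]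
      exact ha.ne'
    exact integral_sq_sub_pos (haarProbability G) hχc hne cbar
  · -- left invariance removes `a`
    have h1 : ∫ g, ((r.ρ (a * g)).trace.re - m) ^ 2 ∂haarProbability G =
        ∫ g, (χ g - m) ^ 2 ∂haarProbability G :=
      integral_mul_left_eq_self (fun g => (χ g - m) ^ 2) a
    rw [h1]
    -- ∫ (χ - m)² = ∫ (χ - cbar)² + (cbar - m)²
    have hi1 : Integrable (fun g => (χ g - cbar) ^ 2) (haarProbability G) :=
      integrable_of_continuous (by fun_prop) _
    have hi2 : Integrable (fun g => 2 * (cbar - m) * (χ g - cbar)) (haarProbability G) :=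
      integrable_of_continuous (by fun_prop) _
    have hi3 : Integrable (fun _ : G => (cbar - m) ^ 2) (haarProbability G) := integrable_const _
    have hexp : (fun g => (χ g - m) ^ 2) =
        fun g => (χ g - cbar) ^ 2 + 2 * (cbar - m) * (χ g - cbar) + (cbar - m) ^ 2 := by
      funext g; ring
    have hlin : ∫ g, (χ g - cbar) ∂haarProbability G = 0 := by
      rw [integral_sub (integrable_of_continuous hχc _) (integrable_const _), integral_const]
      simp [hcbar]
    have hi12 : Integrable (fun g => (χ g - cbar) ^ 2 + 2 * (cbar - m) * (χ g - cbar))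
        (haarProbability G) := hi1.add hi2
    rw [hexp, integral_add hi12 hi3, integral_add hi1 hi2, integral_const_mul, hlin,
      integral_const]
    simp only [probReal_univ, smul_eq_mul, one_mul, mul_zero, add_zero]
    nlinarith [sq_nonneg (cbar - m)]


/-! ### Locality of the Wilson action: changing one link moves the action by `O(1)` -/

omit [MeasurableSpace G] [BorelSpace G] [IsTopologicalGroup G] in
/-- **One-link locality bound**, uniform in the volume: `|S(U) − S(U[e ↦ g])| ≤ B(r)` for all
tori, configurations, links and values (only the `≤ 64` plaquettes through `e` change, each by at
most `2(N + M)`). [folklore] -/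
theorem exists_wilsonAction_update_bound (r : LatticeRep G) :
    ∃ B : ℝ, 0 ≤ B ∧ ∀ (L : ℕ) [NeZero L] (U : GaugeConfig 4 L G) (e : Edge 4 L) (g : G),
      |wilsonAction r.ρ U - wilsonAction r.ρ (Function.update U e g)| ≤ B := by
  obtain ⟨M, hM0, hM⟩ := exists_bound_trace_re_nonneg r.ρ r.continuous
  refine ⟨64 * (2 * ((r.N : ℝ) + M)), by positivity, fun L _ U e g => ?_⟩
  set U' : GaugeConfig 4 L G := Function.update U e g with hU'
  -- per-plaquette cost and its bound
  set c : Plaquette 4 L → GaugeConfig 4 L G → ℝ := fun p V =>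
    (r.N : ℝ) - (r.ρ (plaquetteHolonomy V p.1 p.2.1.1 p.2.1.2)).trace.re with hc
  have hcb : ∀ p V, |c p V| ≤ (r.N : ℝ) + M := fun p V => by
    refine (abs_sub _ _).trans ?_
    rw [Nat.abs_cast]
    exact add_le_add le_rfl (hM _)
  have hS : ∀ V : GaugeConfig 4 L G, wilsonAction r.ρ V = ∑ p, c p V := fun V => rfl
  -- edge sets
  set E : Plaquette 4 L → Finset (Edge 4 L) := fun p =>
    {(p.1, p.2.1.1), (p.1.shift p.2.1.1, p.2.1.2), (p.1.shift p.2.1.2, p.2.1.1), (p.1, p.2.1.2)}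
    with hE
  have hoff : ∀ p, e ∉ E p → c p U = c p U' := by
    intro p hp
    have h1 : (p.1, p.2.1.1) ≠ e := fun h => hp (by rw [← h]; simp [hE])
    have h2 : (p.1.shift p.2.1.1, p.2.1.2) ≠ e := fun h => hp (by rw [← h]; simp [hE])
    have h3 : (p.1.shift p.2.1.2, p.2.1.1) ≠ e := fun h => hp (by rw [← h]; simp [hE])
    have h4 : (p.1, p.2.1.2) ≠ e := fun h => hp (by rw [← h]; simp [hE])
    simp only [hc, hU', plaquetteHolonomy, Function.update_of_ne h1, Function.update_of_ne h2,
      Function.update_of_ne h3, Function.update_of_ne h4]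
  -- the plaquettes through `e`
  set T : Finset (Plaquette 4 L) := Finset.univ.filter fun p => e ∈ E p with hT
  have hsum : wilsonAction r.ρ U - wilsonAction r.ρ U' = ∑ p ∈ T, (c p U - c p U') := by
    rw [hS, hS, ← Finset.sum_sub_distrib, hT, Finset.sum_filter_of_ne]
    intro p _ hne
    by_contra hp
    exact hne (by rw [hoff p hp, sub_self])
  -- `card T ≤ 64`
  have hcard : (T.card : ℝ) ≤ 64 := by
    classical
    set φ : Fin 4 × {q : Fin 4 × Fin 4 // q.1 < q.2} → Plaquette 4 L := fun kq =>
      (![e.1, e.1 - Pi.single kq.2.1.1 1, e.1 - Pi.single kq.2.1.2 1, e.1] kq.1, kq.2) with hφ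
    have hsub : T ⊆ Finset.univ.image φ := by
      intro p hp
      have he : e ∈ E p := (Finset.mem_filter.1 hp).2
      simp only [hE, Finset.mem_insert, Finset.mem_singleton] at he
      rcases he with h | h | h | h
      · refine Finset.mem_image.2 ⟨(0, p.2), Finset.mem_univ _, ?_⟩
        rw [hφ, h]; rfl
      · refine Finset.mem_image.2 ⟨(1, p.2), Finset.mem_univ _, ?_⟩
        rw [hφ, h]
        ext <;> simp [Site.shift]
      · refine Finset.mem_image.2 ⟨(2, p.2), Finset.mem_univ _, ?_⟩
        rw [hφ, h]
        ext <;> simp [Site.shift]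
      · refine Finset.mem_image.2 ⟨(3, p.2), Finset.mem_univ _, ?_⟩
        rw [hφ, h]; rfl
    have h1 : T.card ≤ (Finset.univ.image φ).card := Finset.card_le_card hsub
    have h2 : (Finset.univ.image φ).card ≤ Fintype.card (Fin 4 × {q : Fin 4 × Fin 4 // q.1 < q.2}) :=
      Finset.card_image_le.trans (by rw [Finset.card_univ])
    have h3 : Fintype.card (Fin 4 × {q : Fin 4 × Fin 4 // q.1 < q.2}) ≤ 64 := by
      rw [Fintype.card_prod, Fintype.card_fin]
      have := Fintype.card_subtype_le (fun q : Fin 4 × Fin 4 => q.1 < q.2)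
      rw [Fintype.card_prod, Fintype.card_fin] at this
      omega
    exact_mod_cast h1.trans (h2.trans h3)
  -- assemble
  rw [hsum]
  calc |∑ p ∈ T, (c p U - c p U')| ≤ ∑ p ∈ T, |c p U - c p U'| := Finset.abs_sum_le_sum_abs _ _
    _ ≤ ∑ _p ∈ T, 2 * ((r.N : ℝ) + M) := Finset.sum_le_sum fun p _ => by
        refine (abs_sub _ _).trans ?_
        have := hcb p U; have := hcb p U'
        linarith
    _ = T.card * (2 * ((r.N : ℝ) + M)) := by rw [Finset.sum_const, nsmul_eq_mul]
    _ ≤ 64 * (2 * ((r.N : ℝ) + M)) := by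
        refine mul_le_mul_of_nonneg_right hcard ?_
        positivity


/-! ### The variance floor -/

omit [MeasurableSpace G] [BorelSpace G] [IsTopologicalGroup G] [CompactSpace G] in
/-- Boltzmann-factor comparison from an action bound. [folklore] -/
theorem exp_mul_le_of_abs_sub_le {β B sX sY : ℝ} (h : |sX - sY| ≤ B) :
    Real.exp (-(|β| * B)) * Real.exp (-β * sY) ≤ Real.exp (-β * sX) := by
  rw [← Real.exp_add]
  refine Real.exp_le_exp.2 ?_
  have h2 : |β * (sX - sY)| ≤ |β| * B := by
    rw [abs_mul]; exact mul_le_mul_of_nonneg_left h (abs_nonneg _)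
  have h3 := (abs_le.1 h2).2
  nlinarith

/-- **Volume-uniform variance floor of the time-zero plaquette trace.** For an admissible `(G, r)`
and a coupling `β` there is `v > 0` such that on EVERY torus `(2S+1)⁴`, `S ≥ 1`, the variance of
`U ↦ Re tr ρ(U_p)` (`p` the `(1,2)`-plaquette at the origin) under Wilson's measure is at least `v`
(`v = e^{−2|β|B} · Var_Haar`-floor: free one link against the `≤ 64` plaquettes through it, then
left invariance of Haar measure). [folklore] -/
theorem plaquette_variance_floor (hG : IsCompactSimpleLieGroup G) (r : LatticeRep G) (β : ℝ) :
    ∃ v : ℝ, 0 < v ∧ ∀ S : ℕ, 1 ≤ S →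
      v ≤ ∫ U, ((r.ρ (plaquetteHolonomy U 0 1 2)).trace.re -
          ∫ V, (r.ρ (plaquetteHolonomy V 0 1 2)).trace.re
            ∂(wilsonMeasure (d := 4) (L := 2 * S + 1) r.ρ β)) ^ 2
          ∂(wilsonMeasure (d := 4) (L := 2 * S + 1) r.ρ β) := by
  classical
  obtain ⟨σ, hσ, hσle⟩ := exists_haar_sq_sub_ge hG r
  obtain ⟨B, hB0, hB⟩ := exists_wilsonAction_update_bound r
  set e : ℝ := Real.exp (-(|β| * B)) with he
  have he0 : 0 < e := Real.exp_pos _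
  refine ⟨e * e * σ, by positivity, fun S hS => ?_⟩
  haveI : Fact (1 < 2 * S + 1) := ⟨by omega⟩
  haveI : SecondCountableTopology G :=
    (r.continuous.isClosedEmbedding r.injective).isEmbedding.secondCountableTopology
  set μ := wilsonMeasure (d := 4) (L := 2 * S + 1) r.ρ β with hμ
  haveI hprob : IsProbabilityMeasure μ :=
    isProbabilityMeasure_wilsonMeasure (d := 4) (L := 2 * S + 1) r.ρ r.continuous β
  set f : GaugeConfig 4 (2 * S + 1) G → ℝ := fun U => (r.ρ (plaquetteHolonomy U 0 1 2)).trace.re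
    with hf
  set m : ℝ := ∫ V, f V ∂μ with hm
  set φ : GaugeConfig 4 (2 * S + 1) G → ℝ := fun U => (f U - m) ^ 2 with hφ
  show e * e * σ ≤ ∫ U, φ U ∂μ
  set π : Measure (GaugeConfig 4 (2 * S + 1) G) := Measure.pi fun _ => haarProbability G with hπ
  set w : GaugeConfig 4 (2 * S + 1) G → ℝ := fun U => Real.exp (-β * wilsonAction r.ρ U) with hw
  set l : Edge 4 (2 * S + 1) := ((0 : Site 4 (2 * S + 1)), (1 : Fin 4)) with hl
  set w₁ : GaugeConfig 4 (2 * S + 1) G → ℝ := fun U => w (Function.update U l 1) with hw₁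
  -- continuity / measurability
  have hfc : Continuous f := continuous_re_trace_plaquette r 0 1 2
  have hfm : Measurable f := hfc.measurable
  have hφm : Measurable φ := (hfm.sub measurable_const).pow_const 2
  have hφ0 : ∀ U, 0 ≤ φ U := fun U => sq_nonneg _
  have hwm : Measurable w := ((measurable_wilsonAction r.ρ r.continuous).const_mul _).exp
  have hw₁m : Measurable w₁ := hwm.comp measurable_update_left
  have hw0 : ∀ U, 0 ≤ w U := fun U => (Real.exp_pos _).le
  -- Boltzmann comparisons in both directions
  have hcmp1 : ∀ U, e * w₁ U ≤ w U := fun U =>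
    exp_mul_le_of_abs_sub_le (hB (2 * S + 1) U l 1)
  have hcmp2 : ∀ U, e * w U ≤ w₁ U := fun U => by
    have h := hB (2 * S + 1) U l 1
    rw [abs_sub_comm] at h
    exact exp_mul_le_of_abs_sub_le h
  -- the partition function
  set Z : ℝ≥0∞ := partitionFunction (d := 4) (L := 2 * S + 1) r.ρ β with hZ
  have hZeq : Z = ∫⁻ U, ENNReal.ofReal (w U) ∂π := by
    simp only [hZ, partitionFunction, wilsonWeight, withDensity_apply _ MeasurableSet.univ,
      Measure.restrict_univ, hπ, hw]
  have hZ1 : Z⁻¹ * Z = 1 := by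
    have h1 : μ Set.univ = 1 := measure_univ
    rw [hμ, wilsonMeasure, Measure.smul_apply, smul_eq_mul] at h1
    exact h1
  have hZ0 : Z ≠ 0 := fun h => by simp [h] at hZ1
  have hZtop : Z ≠ ⊤ := fun h => by simp [h] at hZ1
  -- the variance as a lintegral against product Haar measure
  have hμπ : μ = Z⁻¹ • π.withDensity (fun U => ENNReal.ofReal (w U)) := by
    simp only [hμ, wilsonMeasure, wilsonWeight, hZ, hπ, hw]
  have hvar : ∫ U, φ U ∂μ = (∫⁻ U, ENNReal.ofReal (φ U) ∂μ).toReal :=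
    integral_eq_lintegral_of_nonneg_ae (Eventually.of_forall hφ0) hφm.aestronglyMeasurable
  have hlin : ∫⁻ U, ENNReal.ofReal (φ U) ∂μ =
      Z⁻¹ * ∫⁻ U, ENNReal.ofReal (w U) * ENNReal.ofReal (φ U) ∂π := by
    rw [hμπ, lintegral_smul_measure, lintegral_withDensity_eq_lintegral_mul _
      hwm.ennreal_ofReal hφm.ennreal_ofReal]
    rfl
  -- finiteness
  obtain ⟨M, -, hM⟩ := exists_bound_trace_re_nonneg r.ρ r.continuous
  have hφb : ∀ U, φ U ≤ (M + |m|) ^ 2 := fun U => by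
    have h1 : |f U - m| ≤ M + |m| := (abs_sub _ _).trans (add_le_add (hM _) le_rfl)
    calc φ U = |f U - m| ^ 2 := (sq_abs _).symm
      _ ≤ (M + |m|) ^ 2 := pow_le_pow_left₀ (abs_nonneg _) h1 2
  have hfin : ∫⁻ U, ENNReal.ofReal (φ U) ∂μ ≠ ⊤ := by
    refine ne_top_of_le_ne_top (b := ∫⁻ _U, ENNReal.ofReal ((M + |m|) ^ 2) ∂μ) ?_ ?_
    · rw [lintegral_const, measure_univ, mul_one]; exact ENNReal.ofReal_ne_top
    · exact lintegral_mono fun U => ENNReal.ofReal_le_ofReal (hφb U)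
  -- MAIN CHAIN (product Haar): ∫ w φ ≥ e · (e · Z · σ)
  have hstep1 : ENNReal.ofReal e * ∫⁻ U, ENNReal.ofReal (w₁ U) * ENNReal.ofReal (φ U) ∂π ≤
      ∫⁻ U, ENNReal.ofReal (w U) * ENNReal.ofReal (φ U) ∂π := by
    rw [← lintegral_const_mul' _ _ ENNReal.ofReal_ne_top]
    refine lintegral_mono fun U => ?_
    rw [← mul_assoc, ← ENNReal.ofReal_mul he0.le]
    exact mul_le_mul_left (ENNReal.ofReal_le_ofReal (hcmp1 U)) _
  -- one-link marginal
  have hkey : ∀ x : GaugeConfig 4 (2 * S + 1) G,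
      ENNReal.ofReal (w₁ x) * ENNReal.ofReal σ ≤
        ∫⁻ g, ENNReal.ofReal (w₁ (Function.update x l g)) *
          ENNReal.ofReal (φ (Function.update x l g)) ∂haarProbability G := by
    intro x
    have hw₁u : ∀ g, w₁ (Function.update x l g) = w₁ x := fun g => by
      simp only [hw₁, Function.update_idem]
    simp_rw [hw₁u]
    rw [lintegral_const_mul' _ _ ENNReal.ofReal_ne_top]
    refine mul_le_mul_right ?_ _
    -- the one-link integral of φ
    set Vx : G := x (Site.shift 0 1, 2) * (x (Site.shift 0 2, 1))⁻¹ * (x (0, 2))⁻¹ with hVx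
    have hfu : ∀ g, f (Function.update x l g) = (r.ρ (Vx * g)).trace.re := by
      intro g
      have h2 : ((Site.shift (0 : Site 4 (2 * S + 1)) 1, (2 : Fin 4)) : Edge 4 (2 * S + 1)) ≠ l := by
        simp [hl, Prod.ext_iff]
      have h3 : ((Site.shift (0 : Site 4 (2 * S + 1)) 2, (1 : Fin 4)) : Edge 4 (2 * S + 1)) ≠ l := by
        intro h
        have := congrArg (fun e : Edge 4 (2 * S + 1) => e.1 2) h
        simp [Site.shift, hl] at this
      have h4 : (((0 : Site 4 (2 * S + 1)), (2 : Fin 4)) : Edge 4 (2 * S + 1)) ≠ l := by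
        simp [hl, Prod.ext_iff]
      have hhol : plaquetteHolonomy (Function.update x l g) 0 1 2 = g * Vx := by
        simp only [plaquetteHolonomy, hVx, hl]
        rw [Function.update_self, Function.update_of_ne h2, Function.update_of_ne h3,
          Function.update_of_ne h4]
        simp only [mul_assoc]
      simp only [hf, hhol, map_mul]
      rw [Matrix.trace_mul_comm]
    have hφu : ∀ g, φ (Function.update x l g) = ((r.ρ (Vx * g)).trace.re - m) ^ 2 := fun g => by
      simp only [hφ, hfu]
    simp_rw [hφu]
    have hcont : Continuous fun g : G => ((r.ρ (Vx * g)).trace.re - m) ^ 2 :=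
      (((continuous_trace_re r.ρ r.continuous).comp (continuous_const.mul continuous_id)).sub
        continuous_const).pow 2
    rw [← ofReal_integral_eq_lintegral_ofReal (integrable_of_continuous hcont _)
      (Eventually.of_forall fun g => sq_nonneg _)]
    exact ENNReal.ofReal_le_ofReal (hσle m Vx)
  have hstep2 : ∫⁻ U, ENNReal.ofReal (w₁ U) * ENNReal.ofReal σ ∂π ≤
      ∫⁻ U, ENNReal.ofReal (w₁ U) * ENNReal.ofReal (φ U) ∂π := by
    have hΦm : Measurable fun U => ENNReal.ofReal (w₁ U) * ENNReal.ofReal (φ U) :=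
      hw₁m.ennreal_ofReal.mul hφm.ennreal_ofReal
    have hΨm : Measurable fun U => ENNReal.ofReal (w₁ U) * ENNReal.ofReal σ :=
      hw₁m.ennreal_ofReal.mul measurable_const
    rw [hπ, lintegral_eq_lmarginal_univ (1 : GaugeConfig 4 (2 * S + 1) G),
      lintegral_eq_lmarginal_univ (1 : GaugeConfig 4 (2 * S + 1) G),
      ← Finset.sdiff_union_of_subset (Finset.subset_univ {l}),
      lmarginal_union _ _ hΨm Finset.sdiff_disjoint, lmarginal_union _ _ hΦm Finset.sdiff_disjoint]
    refine lmarginal_mono (fun x => ?_) _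
    rw [lmarginal_singleton, lmarginal_singleton]
    have hw₁u : ∀ g, w₁ (Function.update x l g) = w₁ x := fun g => by
      simp only [hw₁, Function.update_idem]
    calc ∫⁻ g, ENNReal.ofReal (w₁ (Function.update x l g)) * ENNReal.ofReal σ ∂haarProbability G
        = ENNReal.ofReal (w₁ x) * ENNReal.ofReal σ := by
          simp_rw [hw₁u]; rw [lintegral_const, measure_univ, mul_one]
      _ ≤ _ := hkey x
  have hstep3 : ENNReal.ofReal e * Z ≤ ∫⁻ U, ENNReal.ofReal (w₁ U) ∂π := by
    rw [hZeq, ← lintegral_const_mul' _ _ ENNReal.ofReal_ne_top]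
    refine lintegral_mono fun U => ?_
    rw [← ENNReal.ofReal_mul he0.le]
    exact ENNReal.ofReal_le_ofReal (hcmp2 U)
  -- assemble in ℝ≥0∞
  have hchain : ENNReal.ofReal e * (ENNReal.ofReal e * Z * ENNReal.ofReal σ) ≤
      ∫⁻ U, ENNReal.ofReal (w U) * ENNReal.ofReal (φ U) ∂π := by
    refine le_trans ?_ hstep1
    refine mul_le_mul_right ?_ _
    refine le_trans ?_ hstep2
    rw [lintegral_mul_const' _ _ ENNReal.ofReal_ne_top]
    exact mul_le_mul_left hstep3 _
  have hgoal : ENNReal.ofReal (e * e * σ) ≤ ∫⁻ U, ENNReal.ofReal (φ U) ∂μ := by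
    rw [hlin]
    calc ENNReal.ofReal (e * e * σ) = Z⁻¹ * (ENNReal.ofReal e * (ENNReal.ofReal e * Z * ENNReal.ofReal σ)) := by
          rw [ENNReal.ofReal_mul (by positivity), ENNReal.ofReal_mul he0.le]
          calc ENNReal.ofReal e * ENNReal.ofReal e * ENNReal.ofReal σ
              = (Z⁻¹ * Z) * (ENNReal.ofReal e * ENNReal.ofReal e * ENNReal.ofReal σ) := by
                rw [hZ1, one_mul]
            _ = _ := by ring
      _ ≤ _ := mul_le_mul_right hchain _
  rw [hvar]
  exact (ENNReal.ofReal_le_iff_le_toReal hfin).1 hgoal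


/-! ### The Dirichlet form of the plaquette trace is bounded uniformly in the volume -/

omit [MeasurableSpace G] [BorelSpace G] [CompactSpace G] [IsTopologicalGroup G] in
/-- The metric slope of the origin plaquette trace along any link lies in `[0, 4N⁴]`. [folklore] -/
theorem slope_plaquette_nonneg_and_le (r : LatticeRep G) {S : ℕ} (U : GaugeConfig 4 (2 * S + 1) G)
    (e : Edge 4 (2 * S + 1)) :
    0 ≤ Filter.limsup (fun g : G =>
        |(r.ρ (plaquetteHolonomy (Function.update U e g) 0 1 2)).trace.re -
            (r.ρ (plaquetteHolonomy U 0 1 2)).trace.re| /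
          Real.sqrt (∑ a, ∑ b, ‖(r.ρ g - r.ρ (U e)) a b‖ ^ 2)) (𝓝[≠] (U e)) ∧
      Filter.limsup (fun g : G =>
        |(r.ρ (plaquetteHolonomy (Function.update U e g) 0 1 2)).trace.re -
            (r.ρ (plaquetteHolonomy U 0 1 2)).trace.re| /
          Real.sqrt (∑ a, ∑ b, ‖(r.ρ g - r.ρ (U e)) a b‖ ^ 2)) (𝓝[≠] (U e)) ≤ 4 * (r.N : ℝ) ^ 4 := by
  refine limsup_nonneg_and_le _ (by positivity)
    (fun g => div_nonneg (abs_nonneg _) (Real.sqrt_nonneg _)) (Eventually.of_forall fun g => ?_)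
  rw [sqrt_sum_sq_eq_norm]
  rcases (norm_nonneg (r.ρ g - r.ρ (U e))).eq_or_lt with h0 | hpos
  · rw [← h0, div_zero]; positivity
  · rw [div_le_iff₀ hpos]
    have h := abs_re_trace_plaquette_sub_le r 0 1 2 (Function.update U e g) U
    have hsum : ∑ e', Real.sqrt (∑ a, ∑ b, ‖(r.ρ (Function.update U e g e') - r.ρ (U e')) a b‖ ^ 2) =
        ‖r.ρ g - r.ρ (U e)‖ := by
      rw [Finset.sum_eq_single e]
      · rw [Function.update_self, sqrt_sum_sq_eq_norm]
      · intro e' _ hne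
        rw [Function.update_of_ne hne, sub_self]
        simp
      · intro h'; exact absurd (Finset.mem_univ e) h'
    rw [hsum] at h
    exact h

omit [MeasurableSpace G] [BorelSpace G] [CompactSpace G] [IsTopologicalGroup G] in
/-- Off the four links of the origin plaquette the metric slope of its trace vanishes. [folklore] -/
theorem slope_plaquette_eq_zero (r : LatticeRep G) {S : ℕ} (U : GaugeConfig 4 (2 * S + 1) G)
    {e : Edge 4 (2 * S + 1)}
    (he : e ∉ ({((0 : Site 4 (2 * S + 1)), (1 : Fin 4)), (Site.shift 0 1, 2), (Site.shift 0 2, 1),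
      (0, 2)} : Finset (Edge 4 (2 * S + 1)))) :
    Filter.limsup (fun g : G =>
        |(r.ρ (plaquetteHolonomy (Function.update U e g) 0 1 2)).trace.re -
            (r.ρ (plaquetteHolonomy U 0 1 2)).trace.re| /
          Real.sqrt (∑ a, ∑ b, ‖(r.ρ g - r.ρ (U e)) a b‖ ^ 2)) (𝓝[≠] (U e)) = 0 := by
  have h1 : (((0 : Site 4 (2 * S + 1)), (1 : Fin 4)) : Edge 4 (2 * S + 1)) ≠ e :=
    fun h => he (by rw [← h]; simp)
  have h2 : ((Site.shift (0 : Site 4 (2 * S + 1)) 1, (2 : Fin 4)) : Edge 4 (2 * S + 1)) ≠ e :=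
    fun h => he (by rw [← h]; simp)
  have h3 : ((Site.shift (0 : Site 4 (2 * S + 1)) 2, (1 : Fin 4)) : Edge 4 (2 * S + 1)) ≠ e :=
    fun h => he (by rw [← h]; simp)
  have h4 : (((0 : Site 4 (2 * S + 1)), (2 : Fin 4)) : Edge 4 (2 * S + 1)) ≠ e :=
    fun h => he (by rw [← h]; simp)
  have hhol : ∀ g, plaquetteHolonomy (Function.update U e g) 0 1 2 = plaquetteHolonomy U 0 1 2 := by
    intro g
    simp only [plaquetteHolonomy, Function.update_of_ne h1, Function.update_of_ne h2,
      Function.update_of_ne h3, Function.update_of_ne h4]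
  simp_rw [hhol, sub_self, abs_zero, zero_div]
  exact limsup_const_zero _

/-- **The time-zero Dirichlet form of the origin plaquette trace is `≤ 4 · (4N⁴)²`, uniformly in the
volume** (crux vocabulary: `dir f = Σ_{t=0 spatial ℓ} ∫ slope² dμ`). [folklore] -/
theorem dir_plaquette_le (r : LatticeRep G) (β : ℝ) (S : ℕ) :
    let μ := wilsonMeasure (d := 4) (L := 2 * S + 1) r.ρ β
    let fro : Matrix (Fin r.N) (Fin r.N) ℂ → ℝ := fun M => ∑ a, ∑ b, ‖M a b‖ ^ 2
    let slope : (GaugeConfig 4 (2 * S + 1) G → ℝ) → GaugeConfig 4 (2 * S + 1) G →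
        Edge 4 (2 * S + 1) → ℝ := fun f U e =>
      Filter.limsup (fun g : G => |f (Function.update U e g) - f U| /
        Real.sqrt (fro (r.ρ g - r.ρ (U e)))) (𝓝[≠] (U e))
    let dir : (GaugeConfig 4 (2 * S + 1) G → ℝ) → ℝ := fun f =>
      ∑ e : Edge 4 (2 * S + 1), (if e.1 0 = 0 ∧ e.2 ≠ 0 then ∫ U, (slope f U e) ^ 2 ∂μ else 0)
    dir (fun U => (r.ρ (plaquetteHolonomy U 0 1 2)).trace.re) ≤ 4 * (4 * (r.N : ℝ) ^ 4) ^ 2 := by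
  intro μ fro slope dir
  haveI : SecondCountableTopology G :=
    (r.continuous.isClosedEmbedding r.injective).isEmbedding.secondCountableTopology
  haveI := isProbabilityMeasure_wilsonMeasure (d := 4) (L := 2 * S + 1) r.ρ r.continuous β
  set E₀ : Finset (Edge 4 (2 * S + 1)) := {((0 : Site 4 (2 * S + 1)), (1 : Fin 4)),
    (Site.shift 0 1, 2), (Site.shift 0 2, 1), (0, 2)} with hE₀
  set K : ℝ := 4 * (r.N : ℝ) ^ 4 with hK
  have hterm : ∀ e : Edge 4 (2 * S + 1),
      (if e.1 0 = 0 ∧ e.2 ≠ 0 then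
        ∫ U, (slope (fun U => (r.ρ (plaquetteHolonomy U 0 1 2)).trace.re) U e) ^ 2 ∂μ else 0) ≤
      (if e ∈ E₀ then K ^ 2 else 0) := by
    intro e
    by_cases he : e ∈ E₀
    · rw [if_pos he]
      split_ifs
      · have hpt : ∀ U, (slope (fun U => (r.ρ (plaquetteHolonomy U 0 1 2)).trace.re) U e) ^ 2 ≤ K ^ 2 :=
          fun U => by
            have h := slope_plaquette_nonneg_and_le r U e
            exact pow_le_pow_left₀ h.1 h.2 2
        calc _ ≤ ∫ _U, K ^ 2 ∂μ := integral_mono_of_nonneg (Eventually.of_forall fun U => sq_nonneg _)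
              (integrable_const _) (Eventually.of_forall hpt)
          _ = K ^ 2 := by rw [integral_const, smul_eq_mul, probReal_univ, one_mul]
      · positivity
    · rw [if_neg he]
      split_ifs
      · have h0 : ∀ U, slope (fun U => (r.ρ (plaquetteHolonomy U 0 1 2)).trace.re) U e = 0 :=
          fun U => slope_plaquette_eq_zero r U he
        simp [h0]
      · exact le_rfl
  calc dir (fun U => (r.ρ (plaquetteHolonomy U 0 1 2)).trace.re)
      ≤ ∑ e : Edge 4 (2 * S + 1), (if e ∈ E₀ then K ^ 2 else 0) := Finset.sum_le_sum fun e _ => hterm e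
    _ = ∑ e ∈ E₀, K ^ 2 := by rw [Finset.sum_ite_mem, Finset.univ_inter]
    _ = E₀.card * K ^ 2 := by rw [Finset.sum_const, nsmul_eq_mul]
    _ ≤ 4 * K ^ 2 := by
        refine mul_le_mul_of_nonneg_right ?_ (by positivity)
        have h : E₀.card ≤ 4 := by
          rw [hE₀]
          refine (Finset.card_insert_le _ _).trans ?_
          refine (Nat.succ_le_succ (Finset.card_insert_le _ _)).trans ?_
          refine (Nat.succ_le_succ (Nat.succ_le_succ (Finset.card_insert_le _ _))).trans ?_
          rw [Finset.card_singleton]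
        exact_mod_cast h

/-! ### Assembly against the crux: the covariance scale has a volume-uniform floor -/

/-- `0 ≤ Dmax` (crux vocabulary). [folklore] -/
theorem dmax_nonneg (r : LatticeRep G) (β : ℝ) (S : ℕ) :
    let μ := wilsonMeasure (d := 4) (L := 2 * S + 1) r.ρ β
    let fro : Matrix (Fin r.N) (Fin r.N) ℂ → ℝ := fun M => ∑ a, ∑ b, ‖M a b‖ ^ 2
    let coul : GaugeConfig 4 (2 * S + 1) G → (Site 4 (2 * S + 1) → G) → ℝ := fun U h =>
      -∑ e : Edge 4 (2 * S + 1),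
        (if e.1 0 = 0 ∧ e.2 ≠ 0 then (r.ρ (gaugeTransform h U e)).trace.re else 0)
    let cov : GaugeConfig 4 (2 * S + 1) G → (Site 4 (2 * S + 1) → G) →
        (Fin 3 → ZMod (2 * S + 1)) → ℝ := fun U h p =>
      (∑ j : Fin 3, fro (∑ y : Fin 3 → ZMod (2 * S + 1),
        Complex.exp (-(2 * Real.pi * Complex.I *
          (∑ i : Fin 3, ((p i).val : ℂ) * ((y i).val : ℂ)) / (2 * S + 1 : ℂ))) •
        ((1 / 2 : ℂ) • (r.ρ (gaugeTransform h U (Fin.cons (0 : ZMod (2 * S + 1)) y, j.succ)) -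
          (r.ρ (gaugeTransform h U (Fin.cons (0 : ZMod (2 * S + 1)) y, j.succ)))ᴴ)))) /
        ((2 * S + 1 : ℝ) ^ 3)
    let Dmax : ℝ := ⨆ p : Fin 3 → ZMod (2 * S + 1),
      ∫ U, (⨆ h : {h : Site 4 (2 * S + 1) → G // ∀ h', coul U h ≤ coul U h'}, cov U h.1 p) ∂μ
    0 ≤ Dmax := by
  intro μ fro coul cov Dmax
  have hcov0 : ∀ U h p, 0 ≤ cov U h p := fun U h p => by
    refine div_nonneg (Finset.sum_nonneg fun j _ => ?_) (by positivity)
    exact Finset.sum_nonneg fun a _ => Finset.sum_nonneg fun b _ => by positivity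
  exact Real.iSup_nonneg fun p => integral_nonneg fun U =>
    Real.iSup_nonneg fun h => hcov0 U h.1 p

/-- **The SC crux forces a volume-uniform floor on its covariance scale**: if
`ConvexGribovBody.BrascampLiebVacuumSC` holds then at every simply-connected admissible `(G, r)`,
for all `β ≥ β₀(G, r)` there are `c(β) > 0` and `S₁(β)` with `Dmax(β, S) ≥ c(β)` for all
`S ≥ S₁(β)` — test the inequality on the origin plaquette trace (variance `≥ v(β)` by
`plaquette_variance_floor`, Dirichlet form `≤ 4(4N⁴)²` by `dir_plaquette_le`). [folklore] -/
theorem dmax_floor_of_brascampLiebVacuumSC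
    (hBL : Summit.QuantumFields.YangMills.Theses.ConvexGribovBody.BrascampLiebVacuumSC)
    {G : Type} [Group G] [TopologicalSpace G] [IsTopologicalGroup G] [CompactSpace G]
    [MeasurableSpace G] [BorelSpace G] (hG : IsCompactSimpleLieGroup G) (hSC : SimplyConnectedSpace G)
    (r : LatticeRep G) :
    ∃ β₀ : ℝ, ∀ β : ℝ, β₀ ≤ β → ∃ c : ℝ, 0 < c ∧ ∃ S₁ : ℕ, ∀ S : ℕ, S₁ ≤ S →
    let μ := wilsonMeasure (d := 4) (L := 2 * S + 1) r.ρ β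
    let fro : Matrix (Fin r.N) (Fin r.N) ℂ → ℝ := fun M => ∑ a, ∑ b, ‖M a b‖ ^ 2
    let coul : GaugeConfig 4 (2 * S + 1) G → (Site 4 (2 * S + 1) → G) → ℝ := fun U h =>
      -∑ e : Edge 4 (2 * S + 1),
        (if e.1 0 = 0 ∧ e.2 ≠ 0 then (r.ρ (gaugeTransform h U e)).trace.re else 0)
    let cov : GaugeConfig 4 (2 * S + 1) G → (Site 4 (2 * S + 1) → G) →
        (Fin 3 → ZMod (2 * S + 1)) → ℝ := fun U h p =>
      (∑ j : Fin 3, fro (∑ y : Fin 3 → ZMod (2 * S + 1),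
        Complex.exp (-(2 * Real.pi * Complex.I *
          (∑ i : Fin 3, ((p i).val : ℂ) * ((y i).val : ℂ)) / (2 * S + 1 : ℂ))) •
        ((1 / 2 : ℂ) • (r.ρ (gaugeTransform h U (Fin.cons (0 : ZMod (2 * S + 1)) y, j.succ)) -
          (r.ρ (gaugeTransform h U (Fin.cons (0 : ZMod (2 * S + 1)) y, j.succ)))ᴴ)))) /
        ((2 * S + 1 : ℝ) ^ 3)
    let Dmax : ℝ := ⨆ p : Fin 3 → ZMod (2 * S + 1),
      ∫ U, (⨆ h : {h : Site 4 (2 * S + 1) → G // ∀ h', coul U h ≤ coul U h'}, cov U h.1 p) ∂μ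
    c ≤ Dmax := by
  obtain ⟨β₀, hβ⟩ := hBL G hG hSC r
  refine ⟨β₀, fun β hb => ?_⟩
  obtain ⟨C, hC, S₀, hS₀⟩ := hβ β hb
  obtain ⟨v, hv, hvS⟩ := plaquette_variance_floor hG r β
  set k : ℝ := 4 * (4 * (r.N : ℝ) ^ 4) ^ 2 with hk
  have hk0 : 0 < max k 1 := lt_of_lt_of_le one_pos (le_max_right _ _)
  refine ⟨v / (C * max k 1), div_pos hv (mul_pos hC hk0), max S₀ 1, fun S hS => ?_⟩
  intro μ fro coul cov Dmax
  haveI : Fact (1 < 2 * S + 1) := ⟨by omega⟩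
  -- the admissible probe
  have hf₁ : IsGaugeInvariant
      (fun U : GaugeConfig 4 (2 * S + 1) G => (r.ρ (plaquetteHolonomy U 0 1 2)).trace.re) :=
    isGaugeInvariant_re_trace_plaquette r 0 1 2
  have hf₂ : ∀ U V : GaugeConfig 4 (2 * S + 1) G,
      (∀ e : Edge 4 (2 * S + 1), e.1 0 = 0 → e.2 ≠ 0 → U e = V e) →
      (fun U : GaugeConfig 4 (2 * S + 1) G => (r.ρ (plaquetteHolonomy U 0 1 2)).trace.re) U =
      (fun U : GaugeConfig 4 (2 * S + 1) G => (r.ρ (plaquetteHolonomy U 0 1 2)).trace.re) V := by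
    intro U V hUV
    have h10 : (1 : Fin 4) ≠ 0 := by decide
    have h20 : (2 : Fin 4) ≠ 0 := by decide
    simp only [plaquetteHolonomy]
    rw [hUV (0, 1) rfl h10, hUV (Site.shift 0 1, 2) (by simp [Site.shift]) h20,
      hUV (Site.shift 0 2, 1) (by simp [Site.shift]) h10, hUV (0, 2) rfl h20]
  have hf₃ : ∃ K : ℝ, ∀ U V : GaugeConfig 4 (2 * S + 1) G,
      |(fun U : GaugeConfig 4 (2 * S + 1) G => (r.ρ (plaquetteHolonomy U 0 1 2)).trace.re) U -
        (fun U : GaugeConfig 4 (2 * S + 1) G => (r.ρ (plaquetteHolonomy U 0 1 2)).trace.re) V| ≤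
        K * ∑ e, Real.sqrt (fro (r.ρ (U e) - r.ρ (V e))) :=
    ⟨4 * (r.N : ℝ) ^ 4, fun U V => abs_re_trace_plaquette_sub_le r 0 1 2 U V⟩
  have hbody := hS₀ S (le_trans (le_max_left _ _) hS) _ hf₁ hf₂ hf₃
  have hvar := hvS S (le_trans (le_max_right _ _) hS)
  have hdir := dir_plaquette_le r β S
  have hD0 : 0 ≤ Dmax := dmax_nonneg r β S
  -- v ≤ Var ≤ C · Dmax · dir ≤ C · Dmax · max k 1
  have h1 : v ≤ C * Dmax * max k 1 := by
    refine hvar.trans (hbody.trans ?_)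
    exact mul_le_mul_of_nonneg_left (hdir.trans (le_max_left _ _)) (mul_nonneg hC.le hD0)
  rw [div_le_iff₀ (mul_pos hC hk0)]
  calc v ≤ C * Dmax * max k 1 := h1
    _ = Dmax * (C * max k 1) := by ring

/-- **The SC crux is false if its covariance scale degenerates in the volume at some
simply-connected admissible `(G, r)`** (`liminf_{S→∞} Dmax(β, S) = 0` for cofinally many `β`):
the normalisation `Dmax` is load-bearing, and any proof of the crux must establish
`inf_{S ≥ S₁} Dmax(β, S) > 0` — a property of the minimal lattice Coulomb gauge alone. [folklore] -/
theorem brascampLiebVacuumSC_false_of_dmaxDegenerate_inline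
    {G : Type} [Group G] [TopologicalSpace G] [IsTopologicalGroup G] [CompactSpace G]
    [MeasurableSpace G] [BorelSpace G] (hG : IsCompactSimpleLieGroup G) (hSC : SimplyConnectedSpace G)
    (r : LatticeRep G)
    (hD : ∀ β₀ : ℝ, ∃ β : ℝ, β₀ ≤ β ∧ ∀ c : ℝ, 0 < c → ∀ S₁ : ℕ, ∃ S : ℕ, S₁ ≤ S ∧
      let μ := wilsonMeasure (d := 4) (L := 2 * S + 1) r.ρ β
      let fro : Matrix (Fin r.N) (Fin r.N) ℂ → ℝ := fun M => ∑ a, ∑ b, ‖M a b‖ ^ 2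
      let coul : GaugeConfig 4 (2 * S + 1) G → (Site 4 (2 * S + 1) → G) → ℝ := fun U h =>
        -∑ e : Edge 4 (2 * S + 1),
          (if e.1 0 = 0 ∧ e.2 ≠ 0 then (r.ρ (gaugeTransform h U e)).trace.re else 0)
      let cov : GaugeConfig 4 (2 * S + 1) G → (Site 4 (2 * S + 1) → G) →
          (Fin 3 → ZMod (2 * S + 1)) → ℝ := fun U h p =>
        (∑ j : Fin 3, fro (∑ y : Fin 3 → ZMod (2 * S + 1),
          Complex.exp (-(2 * Real.pi * Complex.I *
            (∑ i : Fin 3, ((p i).val : ℂ) * ((y i).val : ℂ)) / (2 * S + 1 : ℂ))) •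
          ((1 / 2 : ℂ) • (r.ρ (gaugeTransform h U (Fin.cons (0 : ZMod (2 * S + 1)) y, j.succ)) -
            (r.ρ (gaugeTransform h U (Fin.cons (0 : ZMod (2 * S + 1)) y, j.succ)))ᴴ)))) /
          ((2 * S + 1 : ℝ) ^ 3)
      let Dmax : ℝ := ⨆ p : Fin 3 → ZMod (2 * S + 1),
        ∫ U, (⨆ h : {h : Site 4 (2 * S + 1) → G // ∀ h', coul U h ≤ coul U h'}, cov U h.1 p) ∂μ
      Dmax < c) :
    ¬ Summit.QuantumFields.YangMills.Theses.ConvexGribovBody.BrascampLiebVacuumSC := by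
  intro hBL
  obtain ⟨β₀, hβ⟩ := dmax_floor_of_brascampLiebVacuumSC hBL hG hSC r
  obtain ⟨β, hb, hdeg⟩ := hD β₀
  obtain ⟨c, hc, S₁, hS₁⟩ := hβ β hb
  obtain ⟨S, hS, hlt⟩ := hdeg c hc S₁
  exact absurd (hS₁ S hS) (not_le.2 hlt)


/-- `PlaquetteVarianceFloor r` holds at every admissible `(G, r)` (probe = origin plaquette trace). [folklore] -/
theorem plaquetteVarianceFloor_of_admissible {G : Type} [Group G] [TopologicalSpace G]
    [IsTopologicalGroup G] [CompactSpace G] [MeasurableSpace G] [BorelSpace G]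
    (hG : IsCompactSimpleLieGroup G) (r : LatticeRep G) : PlaquetteVarianceFloor r := by
  refine ⟨4 * (4 * (r.N : ℝ) ^ 4) ^ 2, fun β => ?_⟩
  obtain ⟨v, hv, hvS⟩ := plaquette_variance_floor hG r β
  refine ⟨v, hv, fun S hS => ?_⟩
  haveI : Fact (1 < 2 * S + 1) := ⟨by omega⟩
  refine ⟨fun U => (r.ρ (plaquetteHolonomy U 0 1 2)).trace.re,
    isGaugeInvariant_re_trace_plaquette r 0 1 2, fun U V hUV => ?_,
    ⟨4 * (r.N : ℝ) ^ 4, fun U V => abs_re_trace_plaquette_sub_le r 0 1 2 U V⟩,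
    dir_plaquette_le r β S, hvS S hS⟩
  have h10 : (1 : Fin 4) ≠ 0 := by decide
  have h20 : (2 : Fin 4) ≠ 0 := by decide
  simp only [plaquetteHolonomy]
  rw [hUV (0, 1) rfl h10, hUV (Site.shift 0 1, 2) (by simp [Site.shift]) h20,
    hUV (Site.shift 0 2, 1) (by simp [Site.shift]) h10, hUV (0, 2) rfl h20]

/-- **G3, final form: the SC crux is false if `Dmax` degenerates in the volume at some
simply-connected admissible `(G, r)`** — no variance hypothesis left. [folklore] -/
theorem brascampLiebVacuumSC_false_of_dmaxDegenerate' {G : Type} [Group G] [TopologicalSpace G]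
    [IsTopologicalGroup G] [CompactSpace G] [MeasurableSpace G] [BorelSpace G]
    (hG : IsCompactSimpleLieGroup G) (hSC : SimplyConnectedSpace G) (r : LatticeRep G)
    (hD : DmaxDegenerate r) :
    ¬ Summit.QuantumFields.YangMills.Theses.ConvexGribovBody.BrascampLiebVacuumSC :=
  brascampLiebVacuumSC_false_of_dmaxDegenerate hG hSC r (plaquetteVarianceFloor_of_admissible hG r) hD

end FloorProofs

/-! ### G1 made unconditional: `SU(2)` is simply connected (landed as
`Theorems/BrascampLiebVacuumSC/Negative/AdmissibleInstance.lean`, `simplyConnectedSpace_su2`) -/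

section SU2

open Quaternion Matrix Complex

/-- `q = a + b i + c j + d k ↦ [[a + b i, c + d i], [-c + d i, a - b i]]`. -/
def quatMat (q : ℍ) : Matrix (Fin 2) (Fin 2) ℂ :=
  !![(q.re : ℂ) + (q.imI : ℂ) * I, (q.imJ : ℂ) + (q.imK : ℂ) * I;
    -(q.imJ : ℂ) + (q.imK : ℂ) * I, (q.re : ℂ) - (q.imI : ℂ) * I]

theorem continuous_quatMat : Continuous quatMat := by
  have hre : Continuous fun q : ℍ => (q.re : ℂ) := continuous_ofReal.comp continuous_re
  have hI : Continuous fun q : ℍ => (q.imI : ℂ) := continuous_ofReal.comp continuous_imI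
  have hJ : Continuous fun q : ℍ => (q.imJ : ℂ) := continuous_ofReal.comp continuous_imJ
  have hK : Continuous fun q : ℍ => (q.imK : ℂ) := continuous_ofReal.comp continuous_imK
  refine continuous_matrix fun i j => ?_
  fin_cases i <;> fin_cases j
  · show Continuous fun q : ℍ => (q.re : ℂ) + (q.imI : ℂ) * I
    exact hre.add (hI.mul continuous_const)
  · show Continuous fun q : ℍ => (q.imJ : ℂ) + (q.imK : ℂ) * I
    exact hJ.add (hK.mul continuous_const)
  · show Continuous fun q : ℍ => -(q.imJ : ℂ) + (q.imK : ℂ) * I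
    exact hJ.neg.add (hK.mul continuous_const)
  · show Continuous fun q : ℍ => (q.re : ℂ) - (q.imI : ℂ) * I
    exact hre.sub (hI.mul continuous_const)

theorem quatMat_mul_star (q : ℍ) (hq : q.re ^ 2 + q.imI ^ 2 + q.imJ ^ 2 + q.imK ^ 2 = 1) :
    quatMat q * star (quatMat q) = 1 := by
  have hq' : (q.re : ℂ) ^ 2 + (q.imI : ℂ) ^ 2 + (q.imJ : ℂ) ^ 2 + (q.imK : ℂ) ^ 2 = 1 := by
    exact_mod_cast hq
  ext i j
  rw [Matrix.star_eq_conjTranspose]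
  fin_cases i <;> fin_cases j <;>
    simp [quatMat, Matrix.mul_apply, Fin.sum_univ_two, Matrix.conjTranspose_apply,
      Complex.conj_ofReal] <;> ring_nf <;> rw [Complex.I_sq] <;> linear_combination hq'

theorem det_quatMat (q : ℍ) (hq : q.re ^ 2 + q.imI ^ 2 + q.imJ ^ 2 + q.imK ^ 2 = 1) :
    (quatMat q).det = 1 := by
  have hq' : (q.re : ℂ) ^ 2 + (q.imI : ℂ) ^ 2 + (q.imJ : ℂ) ^ 2 + (q.imK : ℂ) ^ 2 = 1 := by
    exact_mod_cast hq
  rw [quatMat, Matrix.det_fin_two_of]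
  ring_nf
  rw [Complex.I_sq]
  linear_combination hq'

theorem normSq_eq (q : ℍ) : normSq q = q.re ^ 2 + q.imI ^ 2 + q.imJ ^ 2 + q.imK ^ 2 := by
  rw [Quaternion.normSq_def']

theorem sphere_sq (q : Metric.sphere (0 : ℍ) 1) :
    (q : ℍ).re ^ 2 + (q : ℍ).imI ^ 2 + (q : ℍ).imJ ^ 2 + (q : ℍ).imK ^ 2 = 1 := by
  rw [← normSq_eq]
  exact Literature.AlgebraicTopology.FundamentalGroup.normSq_coe_sphere q

theorem quatMat_mem (q : Metric.sphere (0 : ℍ) 1) :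
    quatMat q ∈ Matrix.specialUnitaryGroup (Fin 2) ℂ := by
  rw [Matrix.mem_specialUnitaryGroup_iff, Matrix.mem_unitaryGroup_iff]
  exact ⟨quatMat_mul_star q (sphere_sq q), det_quatMat q (sphere_sq q)⟩

/-- The map `S³ → SU(2)`. -/
def toSU2 (q : Metric.sphere (0 : ℍ) 1) : Matrix.specialUnitaryGroup (Fin 2) ℂ :=
  ⟨quatMat q, quatMat_mem q⟩

theorem continuous_toSU2 : Continuous toSU2 :=
  Continuous.subtype_mk (continuous_quatMat.comp continuous_subtype_val) _

theorem injective_toSU2 : Function.Injective toSU2 := by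
  intro p q h
  have h' : quatMat p = quatMat q := congrArg Subtype.val h
  have h00 := congrFun (congrFun h' 0) 0
  have h01 := congrFun (congrFun h' 0) 1
  simp only [quatMat, Matrix.of_apply, Matrix.cons_val', Matrix.cons_val_zero,
    Matrix.cons_val_one, Matrix.cons_val_fin_one, Matrix.empty_val'] at h00 h01
  have e1 := congrArg Complex.re h00
  have e2 := congrArg Complex.im h00
  have e3 := congrArg Complex.re h01
  have e4 := congrArg Complex.im h01
  simp at e1 e2 e3 e4
  apply Subtype.ext
  ext
  exacts [e1, e2, e3, e4]

/-- Entries of a special unitary `2 × 2` matrix: `A 1 1 = conj (A 0 0)`, `A 1 0 = -conj (A 0 1)`. -/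
theorem su2_entries (A : Matrix.specialUnitaryGroup (Fin 2) ℂ) :
    A.1 1 1 = starRingEnd ℂ (A.1 0 0) ∧ A.1 1 0 = -starRingEnd ℂ (A.1 0 1) := by
  obtain ⟨hU, hdet⟩ := Matrix.mem_specialUnitaryGroup_iff.1 A.2
  have h1 : star A.1 * A.1 = 1 := Matrix.mem_unitaryGroup_iff'.1 hU
  have hinv : A.1⁻¹ = star A.1 := Matrix.inv_eq_left_inv h1
  have hadj : A.1⁻¹ = A.1.adjugate := by
    rw [Matrix.inv_def, hdet, Ring.inverse_one, one_smul]
  have hsa : star A.1 = A.1.adjugate := hinv.symm.trans hadj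
  rw [Matrix.adjugate_fin_two] at hsa
  have e00 := congrFun (congrFun hsa 0) 0
  have e10 := congrFun (congrFun hsa 1) 0
  simp only [Matrix.star_apply, Matrix.of_apply, Matrix.cons_val', Matrix.cons_val_zero,
    Matrix.cons_val_one, Matrix.cons_val_fin_one, Matrix.empty_val'] at e00 e10
  refine ⟨?_, ?_⟩
  · rw [← e00]; rfl
  · have : A.1 1 0 = -(star (A.1 0 1)) := by rw [e10]; ring
    rw [this]; rfl

theorem su2_normSq (A : Matrix.specialUnitaryGroup (Fin 2) ℂ) :
    Complex.normSq (A.1 0 0) + Complex.normSq (A.1 0 1) = 1 := by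
  obtain ⟨hU, -⟩ := Matrix.mem_specialUnitaryGroup_iff.1 A.2
  have h1 : A.1 * star A.1 = 1 := Matrix.mem_unitaryGroup_iff.1 hU
  have e := congrFun (congrFun h1 0) 0
  simp only [Matrix.mul_apply, Fin.sum_univ_two, Matrix.star_apply, Matrix.one_apply_eq] at e
  have e' := congrArg Complex.re e
  simp only [Complex.add_re, Complex.one_re] at e'
  rw [Complex.mul_re, Complex.mul_re] at e'
  simp only [Complex.star_def, Complex.conj_re, Complex.conj_im] at e'
  rw [Complex.normSq_apply, Complex.normSq_apply]
  linarith

theorem surjective_toSU2 : Function.Surjective toSU2 := by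
  intro A
  set x := A.1 0 0 with hx
  set y := A.1 0 1 with hy
  obtain ⟨h11, h10⟩ := su2_entries A
  have hn := su2_normSq A
  let q : ℍ := ⟨x.re, x.im, y.re, y.im⟩
  have hq : q.re ^ 2 + q.imI ^ 2 + q.imJ ^ 2 + q.imK ^ 2 = 1 := by
    show x.re ^ 2 + x.im ^ 2 + y.re ^ 2 + y.im ^ 2 = 1
    rw [Complex.normSq_apply, Complex.normSq_apply] at hn
    nlinarith
  have hmem : q ∈ Metric.sphere (0 : ℍ) 1 := by
    rw [mem_sphere_zero_iff_norm]
    have h2 : ‖q‖ * ‖q‖ = 1 := by rw [← Quaternion.normSq_eq_norm_mul_self, normSq_eq]; exact hq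
    nlinarith [norm_nonneg q]
  refine ⟨⟨q, hmem⟩, Subtype.ext ?_⟩
  show quatMat q = A.1
  ext i j
  fin_cases i <;> fin_cases j
  · show (x.re : ℂ) + (x.im : ℂ) * I = A.1 0 0
    rw [hx]; exact Complex.re_add_im _
  · show (y.re : ℂ) + (y.im : ℂ) * I = A.1 0 1
    rw [hy]; exact Complex.re_add_im _
  · show -(y.re : ℂ) + (y.im : ℂ) * I = A.1 1 0
    rw [h10]
    apply Complex.ext <;> simp [hy]
  · show (x.re : ℂ) - (x.im : ℂ) * I = A.1 1 1
    rw [h11]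
    apply Complex.ext <;> simp [hx]

/-- The homeomorphism `S³ ≃ₜ SU(2)`. -/
def sphereHomeoSU2 : Metric.sphere (0 : ℍ) 1 ≃ₜ Matrix.specialUnitaryGroup (Fin 2) ℂ :=
  Continuous.homeoOfEquivCompactToT2
    (f := Equiv.ofBijective toSU2 ⟨injective_toSU2, surjective_toSU2⟩) continuous_toSU2

/-- `SU(2)` is simply connected. -/
theorem simplyConnectedSpace_su2 : SimplyConnectedSpace (Matrix.specialUnitaryGroup (Fin 2) ℂ) :=
  sphereHomeoSU2.toHomotopyEquiv.simplyConnectedSpace_iff.1 inferInstance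


/-- The packaged load-bearing negations, UNCONDITIONAL. [folklore] -/
theorem not_brascampLiebVacuumSC_without_locality' :
    ¬ (∀ (G : Type) [Group G] [TopologicalSpace G] [IsTopologicalGroup G] [CompactSpace G]
        [MeasurableSpace G] [BorelSpace G], IsCompactSimpleLieGroup G → SimplyConnectedSpace G →
        ∀ r : LatticeRep G, PrefixSC (fun β C S => BodyNoLocAt r β C S)) :=
  not_brascampLiebVacuumSC_without_locality simplyConnectedSpace_su2

theorem not_brascampLiebVacuumSC_without_lipschitz' :
    ¬ (∀ (G : Type) [Group G] [TopologicalSpace G] [IsTopologicalGroup G] [CompactSpace G]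
        [MeasurableSpace G] [BorelSpace G], IsCompactSimpleLieGroup G → SimplyConnectedSpace G →
        ∀ r : LatticeRep G, PrefixSC (fun β C S => BodyNoLipAt r β C S)) :=
  not_brascampLiebVacuumSC_without_lipschitz simplyConnectedSpace_su2

/-- Non-vacuity: the SC crux's hypotheses are satisfiable (`SU(2)`, fundamental). [folklore] -/
theorem exists_admissible_simplyConnected :
    ∃ (G : Type) (_ : Group G) (_ : TopologicalSpace G) (_ : IsTopologicalGroup G)
      (_ : CompactSpace G) (_ : MeasurableSpace G) (_ : BorelSpace G),
      IsCompactSimpleLieGroup G ∧ SimplyConnectedSpace G ∧ Nonempty (LatticeRep G) :=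
  ⟨Matrix.specialUnitaryGroup (Fin 2) ℂ, inferInstance, inferInstance, inferInstance, inferInstance,
    borel _, ⟨rfl⟩, isCompactSimpleLieGroup_su2, simplyConnectedSpace_su2, isCompactSimpleLieGroup_su2.2⟩

end SU2

/-! ### G5 — `Dmax` is genuine: its integrand is measurable (Berge), and Parseval bounds it below by
the mean anti-Hermitian mass of the minimal Coulomb gauge (landed as
`Negative/DmaxIntegrandMeasurable.lean` p125238; `Negative/DmaxParsevalBound.lean` to follow) -/

section Genuine

open Set Complex
open Literature.Probability.LatticeModels (torusFourier torusChar prod_stdAddChar_neg stdAddChar_mul_eq_exp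
  torusFourier_plancherel_holds)

/-- **Measurability of a sup over an argmin** (Berge): `X` a topological measurable space whose
open sets are measurable, `K` compact non-empty, `F, c : X × K → ℝ` continuous. Then
`x ↦ sup {c(x, h) | h minimises F(x, ·)}` is measurable — indeed every super-level set
`{x | t ≤ sup}` is the projection of a closed subset of `X × K`, hence closed. [folklore] -/
theorem measurable_iSup_argmin {X K : Type*} [TopologicalSpace X] [MeasurableSpace X]
    [OpensMeasurableSpace X] [TopologicalSpace K] [CompactSpace K] [Nonempty K]
    {F c : X → K → ℝ} (hF : Continuous (uncurry F)) (hc : Continuous (uncurry c)) :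
    Measurable fun x => ⨆ h : {h : K // ∀ h', F x h ≤ F x h'}, c x h.1 := by
  -- pointwise structure: the argmin is non-empty and compact, the sup is attained
  have hFx : ∀ x, Continuous (F x) := fun x => hF.comp (Continuous.prodMk_right x)
  have hcx : ∀ x, Continuous (c x) := fun x => hc.comp (Continuous.prodMk_right x)
  have hne : ∀ x, ∃ h : K, ∀ h', F x h ≤ F x h' := fun x => by
    obtain ⟨h, -, hmin⟩ := isCompact_univ.exists_isMinOn univ_nonempty (hFx x).continuousOn
    exact ⟨h, fun h' => hmin (mem_univ h')⟩
  have hbdd : ∀ x, BddAbove (range fun h : {h : K // ∀ h', F x h ≤ F x h'} => c x h.1) := by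
    intro x
    obtain ⟨M, hM⟩ := isCompact_univ.bddAbove_image (hcx x).continuousOn
    refine ⟨M, ?_⟩
    rintro _ ⟨h, rfl⟩
    exact hM ⟨h.1, mem_univ _, rfl⟩
  -- super-level sets are projections of closed sets
  have hlevel : ∀ t : ℝ, {x | t ≤ ⨆ h : {h : K // ∀ h', F x h ≤ F x h'}, c x h.1} =
      Prod.fst '' {q : X × K | (∀ h', F q.1 q.2 ≤ F q.1 h') ∧ t ≤ c q.1 q.2} := by
    intro t
    ext x
    simp only [mem_setOf_eq, mem_image, Prod.exists, exists_and_right, exists_eq_right]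
    constructor
    · intro ht
      -- the sup is attained on the compact argmin
      have hcl : IsClosed {h : K | ∀ h', F x h ≤ F x h'} := by
        have : {h : K | ∀ h', F x h ≤ F x h'} = ⋂ h', {h | F x h ≤ F x h'} := by
          ext h; simp
        rw [this]
        exact isClosed_iInter fun h' => isClosed_le (hFx x) continuous_const
      obtain ⟨h₀, hh₀⟩ := hne x
      obtain ⟨h₁, hh₁, hmax⟩ := hcl.isCompact.exists_isMaxOn ⟨h₀, hh₀⟩ (hcx x).continuousOn
      refine ⟨h₁, hh₁, ht.trans ?_⟩
      haveI : Nonempty {h : K // ∀ h', F x h ≤ F x h'} := ⟨⟨h₀, hh₀⟩⟩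
      exact ciSup_le fun h => hmax h.2
    · rintro ⟨h, hh, ht⟩
      exact ht.trans (le_ciSup (hbdd x) ⟨h, hh⟩)
  have hclosed : ∀ t : ℝ, IsClosed {q : X × K | (∀ h', F q.1 q.2 ≤ F q.1 h') ∧ t ≤ c q.1 q.2} := by
    intro t
    have h1 : IsClosed {q : X × K | ∀ h', F q.1 q.2 ≤ F q.1 h'} := by
      have : {q : X × K | ∀ h', F q.1 q.2 ≤ F q.1 h'} = ⋂ h', {q | F q.1 q.2 ≤ F q.1 h'} := by
        ext q; simp
      rw [this]
      refine isClosed_iInter fun h' => isClosed_le hF ?_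
      exact hF.comp (continuous_fst.prodMk continuous_const)
    exact h1.inter (isClosed_le continuous_const hc)
  refine measurable_of_Ici fun t => ?_
  have : (fun x => ⨆ h : {h : K // ∀ h', F x h ≤ F x h'}, c x h.1) ⁻¹' Ici t =
      {x | t ≤ ⨆ h : {h : K // ∀ h', F x h ≤ F x h'}, c x h.1} := rfl
  rw [this, hlevel t]
  exact ((isClosedMap_fst_of_compactSpace _ (hclosed t))).measurableSet


section MeasCrux

variable {G : Type*} [Group G] [TopologicalSpace G] [IsTopologicalGroup G] [CompactSpace G]
  [MeasurableSpace G] [BorelSpace G]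

/-- **The `Dmax` integrand of the crux is measurable**: for every torus, coupling-free data
`(r, S)` and momentum `p`, `U ↦ sup_{h ∈ argmin coul(U, ·)} cov(U, h, p)` (crux vocabulary
verbatim) is a measurable function of the configuration — so `∫ (⨆ h, cov) ∂μ` in `Dmax` is a
genuine integral (not Lean's junk `0` for non-measurable integrands) and LOWER bounds on `Dmax`
can be proved by `integral_mono`. [folklore] -/
theorem measurable_dmaxIntegrand (r : LatticeRep G) (S : ℕ) (p : Fin 3 → ZMod (2 * S + 1)) :
    let fro : Matrix (Fin r.N) (Fin r.N) ℂ → ℝ := fun M => ∑ a, ∑ b, ‖M a b‖ ^ 2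
    let coul : GaugeConfig 4 (2 * S + 1) G → (Site 4 (2 * S + 1) → G) → ℝ := fun U h =>
      -∑ e : Edge 4 (2 * S + 1),
        (if e.1 0 = 0 ∧ e.2 ≠ 0 then (r.ρ (gaugeTransform h U e)).trace.re else 0)
    let cov : GaugeConfig 4 (2 * S + 1) G → (Site 4 (2 * S + 1) → G) →
        (Fin 3 → ZMod (2 * S + 1)) → ℝ := fun U h p =>
      (∑ j : Fin 3, fro (∑ y : Fin 3 → ZMod (2 * S + 1),
        Complex.exp (-(2 * Real.pi * Complex.I *
          (∑ i : Fin 3, ((p i).val : ℂ) * ((y i).val : ℂ)) / (2 * S + 1 : ℂ))) •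
        ((1 / 2 : ℂ) • (r.ρ (gaugeTransform h U (Fin.cons (0 : ZMod (2 * S + 1)) y, j.succ)) -
          (r.ρ (gaugeTransform h U (Fin.cons (0 : ZMod (2 * S + 1)) y, j.succ)))ᴴ)))) /
        ((2 * S + 1 : ℝ) ^ 3)
    Measurable fun U : GaugeConfig 4 (2 * S + 1) G =>
      ⨆ h : {h : Site 4 (2 * S + 1) → G // ∀ h', coul U h ≤ coul U h'}, cov U h.1 p := by
  intro fro coul cov
  haveI : SecondCountableTopology G :=
    (r.continuous.isClosedEmbedding r.injective).isEmbedding.secondCountableTopology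
  -- continuity of the gauge-transformed link as a function of `(U, h)`
  have hgt : ∀ e : Edge 4 (2 * S + 1), Continuous fun q : GaugeConfig 4 (2 * S + 1) G ×
      (Site 4 (2 * S + 1) → G) => gaugeTransform q.2 q.1 e := by
    intro e
    simp only [gaugeTransform]
    fun_prop
  have hρgt : ∀ e : Edge 4 (2 * S + 1), Continuous fun q : GaugeConfig 4 (2 * S + 1) G ×
      (Site 4 (2 * S + 1) → G) => r.ρ (gaugeTransform q.2 q.1 e) := fun e =>
    r.continuous.comp (hgt e)
  have hcoul : Continuous (uncurry coul) := by
    change Continuous fun q : GaugeConfig 4 (2 * S + 1) G × (Site 4 (2 * S + 1) → G) =>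
      -∑ e : Edge 4 (2 * S + 1),
        (if e.1 0 = 0 ∧ e.2 ≠ 0 then (r.ρ (gaugeTransform q.2 q.1 e)).trace.re else 0)
    refine (continuous_finsetSum _ fun e _ => ?_).neg
    split_ifs
    · exact Complex.continuous_re.comp (Continuous.matrix_trace (hρgt e))
    · exact continuous_const
  have hfro : Continuous fro := by
    change Continuous fun M : Matrix (Fin r.N) (Fin r.N) ℂ => ∑ a, ∑ b, ‖M a b‖ ^ 2
    refine continuous_finsetSum _ fun a _ => continuous_finsetSum _ fun b _ => ?_
    exact ((continuous_apply_apply a b).norm).pow 2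
  have hcov : Continuous (uncurry fun U h => cov U h p) := by
    change Continuous fun q : GaugeConfig 4 (2 * S + 1) G × (Site 4 (2 * S + 1) → G) =>
      (∑ j : Fin 3, fro (∑ y : Fin 3 → ZMod (2 * S + 1),
        Complex.exp (-(2 * Real.pi * Complex.I *
          (∑ i : Fin 3, ((p i).val : ℂ) * ((y i).val : ℂ)) / (2 * S + 1 : ℂ))) •
        ((1 / 2 : ℂ) • (r.ρ (gaugeTransform q.2 q.1 (Fin.cons (0 : ZMod (2 * S + 1)) y, j.succ)) -
          (r.ρ (gaugeTransform q.2 q.1 (Fin.cons (0 : ZMod (2 * S + 1)) y, j.succ)))ᴴ)))) /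
        ((2 * S + 1 : ℝ) ^ 3)
    refine (continuous_finsetSum _ fun j _ => hfro.comp ?_).div_const _
    refine continuous_finsetSum _ fun y _ => ?_
    have h1 : Continuous fun q : GaugeConfig 4 (2 * S + 1) G × (Site 4 (2 * S + 1) → G) =>
        r.ρ (gaugeTransform q.2 q.1 (Fin.cons (0 : ZMod (2 * S + 1)) y, j.succ)) -
          (r.ρ (gaugeTransform q.2 q.1 (Fin.cons (0 : ZMod (2 * S + 1)) y, j.succ)))ᴴ :=
      (hρgt _).sub (Continuous.matrix_conjTranspose (hρgt _))
    exact (h1.const_smul ((1 / 2 : ℂ))).const_smul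
      (Complex.exp (-(2 * Real.pi * Complex.I *
        (∑ i : Fin 3, ((p i).val : ℂ) * ((y i).val : ℂ)) / (2 * S + 1 : ℂ))))
  haveI : Nonempty (Site 4 (2 * S + 1) → G) := ⟨fun _ => 1⟩
  exact measurable_iSup_argmin hcoul hcov

/-- **The `Dmax` integrand is integrable under Wilson's measure** (measurable and bounded by
`3N(2S+1)³`, cf. `dmax_le_volume`): `Dmax` is a genuine expectation, and `integral_mono` /
`integral_finset_sum` apply to it. [folklore] -/
theorem integrable_dmaxIntegrand (r : LatticeRep G) (β : ℝ) (S : ℕ) (p : Fin 3 → ZMod (2 * S + 1)) :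
    let μ := wilsonMeasure (d := 4) (L := 2 * S + 1) r.ρ β
    let fro : Matrix (Fin r.N) (Fin r.N) ℂ → ℝ := fun M => ∑ a, ∑ b, ‖M a b‖ ^ 2
    let coul : GaugeConfig 4 (2 * S + 1) G → (Site 4 (2 * S + 1) → G) → ℝ := fun U h =>
      -∑ e : Edge 4 (2 * S + 1),
        (if e.1 0 = 0 ∧ e.2 ≠ 0 then (r.ρ (gaugeTransform h U e)).trace.re else 0)
    let cov : GaugeConfig 4 (2 * S + 1) G → (Site 4 (2 * S + 1) → G) →
        (Fin 3 → ZMod (2 * S + 1)) → ℝ := fun U h p =>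
      (∑ j : Fin 3, fro (∑ y : Fin 3 → ZMod (2 * S + 1),
        Complex.exp (-(2 * Real.pi * Complex.I *
          (∑ i : Fin 3, ((p i).val : ℂ) * ((y i).val : ℂ)) / (2 * S + 1 : ℂ))) •
        ((1 / 2 : ℂ) • (r.ρ (gaugeTransform h U (Fin.cons (0 : ZMod (2 * S + 1)) y, j.succ)) -
          (r.ρ (gaugeTransform h U (Fin.cons (0 : ZMod (2 * S + 1)) y, j.succ)))ᴴ)))) /
        ((2 * S + 1 : ℝ) ^ 3)
    Integrable (fun U : GaugeConfig 4 (2 * S + 1) G =>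
      ⨆ h : {h : Site 4 (2 * S + 1) → G // ∀ h', coul U h ≤ coul U h'}, cov U h.1 p) μ := by
  intro μ fro coul cov
  haveI : SecondCountableTopology G :=
    (r.continuous.isClosedEmbedding r.injective).isEmbedding.secondCountableTopology
  -- continuity of the gauge-transformed link as a function of `(U, h)`
  have hgt : ∀ e : Edge 4 (2 * S + 1), Continuous fun q : GaugeConfig 4 (2 * S + 1) G ×
      (Site 4 (2 * S + 1) → G) => gaugeTransform q.2 q.1 e := by
    intro e
    simp only [gaugeTransform]
    fun_prop
  have hρgt : ∀ e : Edge 4 (2 * S + 1), Continuous fun q : GaugeConfig 4 (2 * S + 1) G ×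
      (Site 4 (2 * S + 1) → G) => r.ρ (gaugeTransform q.2 q.1 e) := fun e =>
    r.continuous.comp (hgt e)
  have hcoul : Continuous (uncurry coul) := by
    change Continuous fun q : GaugeConfig 4 (2 * S + 1) G × (Site 4 (2 * S + 1) → G) =>
      -∑ e : Edge 4 (2 * S + 1),
        (if e.1 0 = 0 ∧ e.2 ≠ 0 then (r.ρ (gaugeTransform q.2 q.1 e)).trace.re else 0)
    refine (continuous_finsetSum _ fun e _ => ?_).neg
    split_ifs
    · exact Complex.continuous_re.comp (Continuous.matrix_trace (hρgt e))
    · exact continuous_const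
  have hfro : Continuous fro := by
    change Continuous fun M : Matrix (Fin r.N) (Fin r.N) ℂ => ∑ a, ∑ b, ‖M a b‖ ^ 2
    refine continuous_finsetSum _ fun a _ => continuous_finsetSum _ fun b _ => ?_
    exact ((continuous_apply_apply a b).norm).pow 2
  have hcov : Continuous (uncurry fun U h => cov U h p) := by
    change Continuous fun q : GaugeConfig 4 (2 * S + 1) G × (Site 4 (2 * S + 1) → G) =>
      (∑ j : Fin 3, fro (∑ y : Fin 3 → ZMod (2 * S + 1),
        Complex.exp (-(2 * Real.pi * Complex.I *
          (∑ i : Fin 3, ((p i).val : ℂ) * ((y i).val : ℂ)) / (2 * S + 1 : ℂ))) •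
        ((1 / 2 : ℂ) • (r.ρ (gaugeTransform q.2 q.1 (Fin.cons (0 : ZMod (2 * S + 1)) y, j.succ)) -
          (r.ρ (gaugeTransform q.2 q.1 (Fin.cons (0 : ZMod (2 * S + 1)) y, j.succ)))ᴴ)))) /
        ((2 * S + 1 : ℝ) ^ 3)
    refine (continuous_finsetSum _ fun j _ => hfro.comp ?_).div_const _
    refine continuous_finsetSum _ fun y _ => ?_
    have h1 : Continuous fun q : GaugeConfig 4 (2 * S + 1) G × (Site 4 (2 * S + 1) → G) =>
        r.ρ (gaugeTransform q.2 q.1 (Fin.cons (0 : ZMod (2 * S + 1)) y, j.succ)) -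
          (r.ρ (gaugeTransform q.2 q.1 (Fin.cons (0 : ZMod (2 * S + 1)) y, j.succ)))ᴴ :=
      (hρgt _).sub (Continuous.matrix_conjTranspose (hρgt _))
    exact (h1.const_smul ((1 / 2 : ℂ))).const_smul
      (Complex.exp (-(2 * Real.pi * Complex.I *
        (∑ i : Fin 3, ((p i).val : ℂ) * ((y i).val : ℂ)) / (2 * S + 1 : ℂ))))
  haveI : Nonempty (Site 4 (2 * S + 1) → G) := ⟨fun _ => 1⟩
  have hmeas : Measurable fun U : GaugeConfig 4 (2 * S + 1) G =>
      ⨆ h : {h : Site 4 (2 * S + 1) → G // ∀ h', coul U h ≤ coul U h'}, cov U h.1 p :=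
    measurable_iSup_argmin hcoul hcov
  have hcard : (Fintype.card (Fin 3 → ZMod (2 * S + 1)) : ℝ) = (2 * S + 1 : ℝ) ^ 3 := by
    rw [Fintype.card_fun, ZMod.card, Fintype.card_fin]; push_cast; ring
  have hsq : ((2 * S + 1 : ℝ) ^ 3 * Real.sqrt r.N) ^ 2 = (r.N : ℝ) * ((2 * S + 1 : ℝ) ^ 3) ^ 2 := by
    rw [mul_pow, Real.sq_sqrt (Nat.cast_nonneg _)]; ring
  have hcov : ∀ U h p, cov U h p ≤ 3 * (r.N : ℝ) * (2 * S + 1 : ℝ) ^ 3 := by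
    intro U h p
    have hj : ∀ j : Fin 3, fro (∑ y : Fin 3 → ZMod (2 * S + 1),
        Complex.exp (-(2 * Real.pi * Complex.I *
          (∑ i : Fin 3, ((p i).val : ℂ) * ((y i).val : ℂ)) / (2 * S + 1 : ℂ))) •
        ((1 / 2 : ℂ) • (r.ρ (gaugeTransform h U (Fin.cons (0 : ZMod (2 * S + 1)) y, j.succ)) -
          (r.ρ (gaugeTransform h U (Fin.cons (0 : ZMod (2 * S + 1)) y, j.succ)))ᴴ))) ≤
        (r.N : ℝ) * ((2 * S + 1 : ℝ) ^ 3) ^ 2 := fun j => by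
      have h1 := sum_norm_sq_sum_smul_le (ι := Fin 3 → ZMod (2 * S + 1))
        (fun y => Complex.exp (-(2 * Real.pi * Complex.I *
          (∑ i : Fin 3, ((p i).val : ℂ) * ((y i).val : ℂ)) / (2 * S + 1 : ℂ))))
        (fun y => (1 / 2 : ℂ) • (r.ρ (gaugeTransform h U (Fin.cons (0 : ZMod (2 * S + 1)) y, j.succ)) -
          (r.ρ (gaugeTransform h U (Fin.cons (0 : ZMod (2 * S + 1)) y, j.succ)))ᴴ))
        (fun y => norm_exp_phase S p y) (fun y => norm_antiHermitianPart_le r _)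
      rw [hcard, hsq] at h1
      exact h1
    have hsum : (∑ j : Fin 3, fro (∑ y : Fin 3 → ZMod (2 * S + 1),
        Complex.exp (-(2 * Real.pi * Complex.I *
          (∑ i : Fin 3, ((p i).val : ℂ) * ((y i).val : ℂ)) / (2 * S + 1 : ℂ))) •
        ((1 / 2 : ℂ) • (r.ρ (gaugeTransform h U (Fin.cons (0 : ZMod (2 * S + 1)) y, j.succ)) -
          (r.ρ (gaugeTransform h U (Fin.cons (0 : ZMod (2 * S + 1)) y, j.succ)))ᴴ)))) ≤
        3 * (r.N : ℝ) * (2 * S + 1 : ℝ) ^ 3 * (2 * S + 1 : ℝ) ^ 3 :=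
      calc _ ≤ ∑ _j : Fin 3, (r.N : ℝ) * ((2 * S + 1 : ℝ) ^ 3) ^ 2 :=
            Finset.sum_le_sum fun j _ => hj j
        _ = 3 * (r.N : ℝ) * (2 * S + 1 : ℝ) ^ 3 * (2 * S + 1 : ℝ) ^ 3 := by
            rw [Finset.sum_const, Finset.card_univ, Fintype.card_fin, nsmul_eq_mul]; push_cast; ring
    exact (div_le_iff₀ (by positivity)).2 hsum
  have hcov0 : ∀ U h p, 0 ≤ cov U h p := fun U h p => by
    refine div_nonneg (Finset.sum_nonneg fun j _ => ?_) (by positivity)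
    exact Finset.sum_nonneg fun a _ => Finset.sum_nonneg fun b _ => by positivity
  have hB : 0 ≤ 3 * (r.N : ℝ) * (2 * S + 1 : ℝ) ^ 3 := by positivity
  haveI := isProbabilityMeasure_wilsonMeasure (d := 4) (L := 2 * S + 1) r.ρ r.continuous β
  refine Integrable.of_bound hmeas.aestronglyMeasurable (3 * (r.N : ℝ) * (2 * S + 1 : ℝ) ^ 3)
    (Eventually.of_forall fun U => ?_)
  have h0 : 0 ≤ ⨆ h : {h : Site 4 (2 * S + 1) → G // ∀ h', coul U h ≤ coul U h'}, cov U h.1 p :=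
    Real.iSup_nonneg fun h => hcov0 U h.1 p
  have h1 : (⨆ h : {h : Site 4 (2 * S + 1) → G // ∀ h', coul U h ≤ coul U h'}, cov U h.1 p) ≤
      3 * (r.N : ℝ) * (2 * S + 1 : ℝ) ^ 3 := Real.iSup_le (fun h => hcov U h.1 p) hB
  show ‖⨆ h : {h : Site 4 (2 * S + 1) → G // ∀ h', coul U h ≤ coul U h'}, cov U h.1 p‖ ≤ _
  rw [Real.norm_eq_abs, abs_of_nonneg h0]
  exact h1


end MeasCrux

/-- The crux's Fourier phase is the conjugate torus character:
`exp(−2πi Σᵢ pᵢ.val yᵢ.val / L) = ∏ᵢ e(−pᵢ yᵢ)`. [folklore] -/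
theorem cruxPhase_eq_prod_stdAddChar (S : ℕ) (p y : Fin 3 → ZMod (2 * S + 1)) :
    Complex.exp (-(2 * Real.pi * Complex.I *
        (∑ i : Fin 3, ((p i).val : ℂ) * ((y i).val : ℂ)) / (2 * S + 1 : ℂ))) =
      ∏ i, (ZMod.stdAddChar (-(p i * y i)) : ℂ) := by
  rw [prod_stdAddChar_neg, torusChar]
  simp_rw [stdAddChar_mul_eq_exp]
  rw [← Complex.exp_sum, ← Complex.exp_conj, map_sum]
  congr 1
  rw [Finset.mul_sum, Finset.sum_div, ← Finset.sum_neg_distrib]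
  refine Finset.sum_congr rfl fun i _ => ?_
  have hL : ((2 * S + 1 : ℕ) : ℂ) = (2 * S + 1 : ℂ) := by push_cast; ring
  rw [← hL]
  simp only [map_div₀, map_mul, map_ofNat, Complex.conj_ofReal, Complex.conj_I, map_natCast]
  push_cast
  ring

/-- **Scalar Parseval in the crux's convention**: `Σ_p |Σ_y c(p,y) m_y|² = L³ Σ_y |m_y|²`. [folklore] -/
theorem sum_norm_sq_sum_cruxPhase_mul (S : ℕ) (m : (Fin 3 → ZMod (2 * S + 1)) → ℂ) :
    ∑ p : Fin 3 → ZMod (2 * S + 1), ‖∑ y : Fin 3 → ZMod (2 * S + 1),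
        Complex.exp (-(2 * Real.pi * Complex.I *
          (∑ i : Fin 3, ((p i).val : ℂ) * ((y i).val : ℂ)) / (2 * S + 1 : ℂ))) * m y‖ ^ 2 =
      (2 * S + 1 : ℝ) ^ 3 * ∑ y, ‖m y‖ ^ 2 := by
  have h : ∀ p : Fin 3 → ZMod (2 * S + 1), ∑ y : Fin 3 → ZMod (2 * S + 1),
      Complex.exp (-(2 * Real.pi * Complex.I *
        (∑ i : Fin 3, ((p i).val : ℂ) * ((y i).val : ℂ)) / (2 * S + 1 : ℂ))) * m y =
      torusFourier m p := fun p => by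
    rw [torusFourier]
    refine Finset.sum_congr rfl fun y _ => ?_
    rw [cruxPhase_eq_prod_stdAddChar, mul_comm]
  simp_rw [h]
  have hP := torusFourier_plancherel_holds (d := 3) (L := 2 * S + 1) m
  rw [hP]
  push_cast
  ring

/-- **Matrix Parseval in the crux's convention** (`fro` = squared Frobenius norm):
`Σ_p fro(Σ_y c(p,y) • M_y) = L³ Σ_y fro(M_y)`. [folklore] -/
theorem sum_fro_sum_cruxPhase_smul (S : ℕ) {N : ℕ}
    (M : (Fin 3 → ZMod (2 * S + 1)) → Matrix (Fin N) (Fin N) ℂ) :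
    ∑ p : Fin 3 → ZMod (2 * S + 1), ∑ a, ∑ b, ‖(∑ y : Fin 3 → ZMod (2 * S + 1),
        Complex.exp (-(2 * Real.pi * Complex.I *
          (∑ i : Fin 3, ((p i).val : ℂ) * ((y i).val : ℂ)) / (2 * S + 1 : ℂ))) • M y) a b‖ ^ 2 =
      (2 * S + 1 : ℝ) ^ 3 * ∑ y, ∑ a, ∑ b, ‖M y a b‖ ^ 2 := by
  have happ : ∀ (p : Fin 3 → ZMod (2 * S + 1)) (a b : Fin N),
      (∑ y : Fin 3 → ZMod (2 * S + 1),
        Complex.exp (-(2 * Real.pi * Complex.I *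
          (∑ i : Fin 3, ((p i).val : ℂ) * ((y i).val : ℂ)) / (2 * S + 1 : ℂ))) • M y) a b =
      ∑ y : Fin 3 → ZMod (2 * S + 1),
        Complex.exp (-(2 * Real.pi * Complex.I *
          (∑ i : Fin 3, ((p i).val : ℂ) * ((y i).val : ℂ)) / (2 * S + 1 : ℂ))) * M y a b := by
    intro p a b
    rw [Matrix.sum_apply]
    refine Finset.sum_congr rfl fun y _ => ?_
    rw [Matrix.smul_apply, smul_eq_mul]
  simp_rw [happ]
  rw [Finset.sum_comm]
  simp_rw [Finset.sum_comm (s := (Finset.univ : Finset (Fin 3 → ZMod (2 * S + 1))))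
    (t := (Finset.univ : Finset (Fin N)))]
  simp_rw [sum_norm_sq_sum_cruxPhase_mul, ← Finset.mul_sum]


section ParsevalCrux

variable {G : Type*} [Group G] [TopologicalSpace G] [IsTopologicalGroup G] [CompactSpace G]
  [MeasurableSpace G] [BorelSpace G]

/-- **Parseval lower bound on the covariance scale**: `Dmax ≥ L⁻³ · E[ sup_{h ∈ argmin} Σ_{j,y}
‖A^h_j(y)‖²_F ]` — the sup over momenta dominates the average, the average over momenta of the
per-momentum sups dominates the sup of the average, and the momentum average of `cov` is, by
Parseval, `L⁻³ Σ_{j,y} ‖A^h_j(y)‖²_F` (`A` = anti-Hermitian part of the gauge-fixed slice links).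
Hypothesis: integrability of the `Dmax` integrands (`integrable_dmaxIntegrand`). [folklore] -/
theorem dmax_ge_parseval (r : LatticeRep G) (β : ℝ) (S : ℕ) :
    let μ := wilsonMeasure (d := 4) (L := 2 * S + 1) r.ρ β
    let fro : Matrix (Fin r.N) (Fin r.N) ℂ → ℝ := fun M => ∑ a, ∑ b, ‖M a b‖ ^ 2
    let coul : GaugeConfig 4 (2 * S + 1) G → (Site 4 (2 * S + 1) → G) → ℝ := fun U h =>
      -∑ e : Edge 4 (2 * S + 1),
        (if e.1 0 = 0 ∧ e.2 ≠ 0 then (r.ρ (gaugeTransform h U e)).trace.re else 0)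
    let cov : GaugeConfig 4 (2 * S + 1) G → (Site 4 (2 * S + 1) → G) →
        (Fin 3 → ZMod (2 * S + 1)) → ℝ := fun U h p =>
      (∑ j : Fin 3, fro (∑ y : Fin 3 → ZMod (2 * S + 1),
        Complex.exp (-(2 * Real.pi * Complex.I *
          (∑ i : Fin 3, ((p i).val : ℂ) * ((y i).val : ℂ)) / (2 * S + 1 : ℂ))) •
        ((1 / 2 : ℂ) • (r.ρ (gaugeTransform h U (Fin.cons (0 : ZMod (2 * S + 1)) y, j.succ)) -
          (r.ρ (gaugeTransform h U (Fin.cons (0 : ZMod (2 * S + 1)) y, j.succ)))ᴴ)))) /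
        ((2 * S + 1 : ℝ) ^ 3)
    let Dmax : ℝ := ⨆ p : Fin 3 → ZMod (2 * S + 1),
      ∫ U, (⨆ h : {h : Site 4 (2 * S + 1) → G // ∀ h', coul U h ≤ coul U h'}, cov U h.1 p) ∂μ
    let Amass : GaugeConfig 4 (2 * S + 1) G → (Site 4 (2 * S + 1) → G) → ℝ := fun U h =>
      ∑ j : Fin 3, ∑ y : Fin 3 → ZMod (2 * S + 1),
        fro ((1 / 2 : ℂ) • (r.ρ (gaugeTransform h U (Fin.cons (0 : ZMod (2 * S + 1)) y, j.succ)) -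
          (r.ρ (gaugeTransform h U (Fin.cons (0 : ZMod (2 * S + 1)) y, j.succ)))ᴴ))
    (∀ p, Integrable (fun U : GaugeConfig 4 (2 * S + 1) G =>
      ⨆ h : {h : Site 4 (2 * S + 1) → G // ∀ h', coul U h ≤ coul U h'}, cov U h.1 p) μ) →
    (1 / (2 * S + 1 : ℝ) ^ 3) *
      ∫ U, (⨆ h : {h : Site 4 (2 * S + 1) → G // ∀ h', coul U h ≤ coul U h'}, Amass U h.1) ∂μ ≤
      Dmax := by
  intro μ fro coul cov Dmax Amass hint
  have hL : (0 : ℝ) < (2 * S + 1 : ℝ) ^ 3 := by positivity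
  have hcard : (Fintype.card (Fin 3 → ZMod (2 * S + 1)) : ℝ) = (2 * S + 1 : ℝ) ^ 3 := by
    rw [Fintype.card_fun, ZMod.card, Fintype.card_fin]; push_cast; ring
  -- pointwise bounds on `cov` (as in `dmax_le_volume`)
  have hsq : ((2 * S + 1 : ℝ) ^ 3 * Real.sqrt r.N) ^ 2 = (r.N : ℝ) * ((2 * S + 1 : ℝ) ^ 3) ^ 2 := by
    rw [mul_pow, Real.sq_sqrt (Nat.cast_nonneg _)]; ring
  have hcov : ∀ U h p, cov U h p ≤ 3 * (r.N : ℝ) * (2 * S + 1 : ℝ) ^ 3 := by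
    intro U h p
    have hj : ∀ j : Fin 3, fro (∑ y : Fin 3 → ZMod (2 * S + 1),
        Complex.exp (-(2 * Real.pi * Complex.I *
          (∑ i : Fin 3, ((p i).val : ℂ) * ((y i).val : ℂ)) / (2 * S + 1 : ℂ))) •
        ((1 / 2 : ℂ) • (r.ρ (gaugeTransform h U (Fin.cons (0 : ZMod (2 * S + 1)) y, j.succ)) -
          (r.ρ (gaugeTransform h U (Fin.cons (0 : ZMod (2 * S + 1)) y, j.succ)))ᴴ))) ≤
        (r.N : ℝ) * ((2 * S + 1 : ℝ) ^ 3) ^ 2 := fun j => by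
      have h1 := sum_norm_sq_sum_smul_le (ι := Fin 3 → ZMod (2 * S + 1))
        (fun y => Complex.exp (-(2 * Real.pi * Complex.I *
          (∑ i : Fin 3, ((p i).val : ℂ) * ((y i).val : ℂ)) / (2 * S + 1 : ℂ))))
        (fun y => (1 / 2 : ℂ) • (r.ρ (gaugeTransform h U (Fin.cons (0 : ZMod (2 * S + 1)) y, j.succ)) -
          (r.ρ (gaugeTransform h U (Fin.cons (0 : ZMod (2 * S + 1)) y, j.succ)))ᴴ))
        (fun y => norm_exp_phase S p y) (fun y => norm_antiHermitianPart_le r _)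
      rw [hcard, hsq] at h1
      exact h1
    have hsum : (∑ j : Fin 3, fro (∑ y : Fin 3 → ZMod (2 * S + 1),
        Complex.exp (-(2 * Real.pi * Complex.I *
          (∑ i : Fin 3, ((p i).val : ℂ) * ((y i).val : ℂ)) / (2 * S + 1 : ℂ))) •
        ((1 / 2 : ℂ) • (r.ρ (gaugeTransform h U (Fin.cons (0 : ZMod (2 * S + 1)) y, j.succ)) -
          (r.ρ (gaugeTransform h U (Fin.cons (0 : ZMod (2 * S + 1)) y, j.succ)))ᴴ)))) ≤
        3 * (r.N : ℝ) * (2 * S + 1 : ℝ) ^ 3 * (2 * S + 1 : ℝ) ^ 3 :=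
      calc _ ≤ ∑ _j : Fin 3, (r.N : ℝ) * ((2 * S + 1 : ℝ) ^ 3) ^ 2 :=
            Finset.sum_le_sum fun j _ => hj j
        _ = 3 * (r.N : ℝ) * (2 * S + 1 : ℝ) ^ 3 * (2 * S + 1 : ℝ) ^ 3 := by
            rw [Finset.sum_const, Finset.card_univ, Fintype.card_fin, nsmul_eq_mul]; push_cast; ring
    exact (div_le_iff₀ (by positivity)).2 hsum
  have hcov0 : ∀ U h p, 0 ≤ cov U h p := fun U h p => by
    refine div_nonneg (Finset.sum_nonneg fun j _ => ?_) (by positivity)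
    exact Finset.sum_nonneg fun a _ => Finset.sum_nonneg fun b _ => by positivity
  have hbdd : ∀ U p, BddAbove (Set.range fun h : {h : Site 4 (2 * S + 1) → G //
      ∀ h', coul U h ≤ coul U h'} => cov U h.1 p) := fun U p =>
    ⟨3 * (r.N : ℝ) * (2 * S + 1 : ℝ) ^ 3, by rintro _ ⟨h, rfl⟩; exact hcov U h.1 p⟩
  -- Parseval: `Σ_p cov U h p = Amass U h`
  have hpars : ∀ U h, ∑ p, cov U h p = Amass U h := by
    intro U h
    change ∑ p : Fin 3 → ZMod (2 * S + 1), (∑ j : Fin 3, fro (∑ y : Fin 3 → ZMod (2 * S + 1),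
        Complex.exp (-(2 * Real.pi * Complex.I *
          (∑ i : Fin 3, ((p i).val : ℂ) * ((y i).val : ℂ)) / (2 * S + 1 : ℂ))) •
        ((1 / 2 : ℂ) • (r.ρ (gaugeTransform h U (Fin.cons (0 : ZMod (2 * S + 1)) y, j.succ)) -
          (r.ρ (gaugeTransform h U (Fin.cons (0 : ZMod (2 * S + 1)) y, j.succ)))ᴴ)))) /
        ((2 * S + 1 : ℝ) ^ 3) = ∑ j : Fin 3, ∑ y : Fin 3 → ZMod (2 * S + 1),
        fro ((1 / 2 : ℂ) • (r.ρ (gaugeTransform h U (Fin.cons (0 : ZMod (2 * S + 1)) y, j.succ)) -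
          (r.ρ (gaugeTransform h U (Fin.cons (0 : ZMod (2 * S + 1)) y, j.succ)))ᴴ))
    rw [← Finset.sum_div, Finset.sum_comm]
    have hj : ∀ j : Fin 3, ∑ p : Fin 3 → ZMod (2 * S + 1), fro (∑ y : Fin 3 → ZMod (2 * S + 1),
        Complex.exp (-(2 * Real.pi * Complex.I *
          (∑ i : Fin 3, ((p i).val : ℂ) * ((y i).val : ℂ)) / (2 * S + 1 : ℂ))) •
        ((1 / 2 : ℂ) • (r.ρ (gaugeTransform h U (Fin.cons (0 : ZMod (2 * S + 1)) y, j.succ)) -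
          (r.ρ (gaugeTransform h U (Fin.cons (0 : ZMod (2 * S + 1)) y, j.succ)))ᴴ))) =
        (2 * S + 1 : ℝ) ^ 3 * ∑ y : Fin 3 → ZMod (2 * S + 1),
          fro ((1 / 2 : ℂ) • (r.ρ (gaugeTransform h U (Fin.cons (0 : ZMod (2 * S + 1)) y, j.succ)) -
            (r.ρ (gaugeTransform h U (Fin.cons (0 : ZMod (2 * S + 1)) y, j.succ)))ᴴ)) :=
      fun j => sum_fro_sum_cruxPhase_smul S _
    simp_rw [hj]
    rw [← Finset.mul_sum, mul_div_cancel_left₀ _ hL.ne']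
  -- Step 1: `L⁻³ Σ_p I_p ≤ Dmax`
  set I : (Fin 3 → ZMod (2 * S + 1)) → ℝ := fun p =>
    ∫ U, (⨆ h : {h : Site 4 (2 * S + 1) → G // ∀ h', coul U h ≤ coul U h'}, cov U h.1 p) ∂μ with hI
  have hIle : ∀ p, I p ≤ Dmax := fun p => le_ciSup (Finite.bddAbove_range I) p
  have h1 : (1 / (2 * S + 1 : ℝ) ^ 3) * ∑ p, I p ≤ Dmax := by
    rw [div_mul_eq_mul_div, one_mul, div_le_iff₀ hL]
    calc ∑ p, I p ≤ ∑ _p : Fin 3 → ZMod (2 * S + 1), Dmax := Finset.sum_le_sum fun p _ => hIle p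
      _ = Dmax * (2 * S + 1 : ℝ) ^ 3 := by
          rw [Finset.sum_const, Finset.card_univ, nsmul_eq_mul, hcard, mul_comm]
  -- Step 2: `∫ sup_h Amass ≤ Σ_p I_p`
  have h2 : ∫ U, (⨆ h : {h : Site 4 (2 * S + 1) → G // ∀ h', coul U h ≤ coul U h'}, Amass U h.1) ∂μ ≤
      ∑ p, I p := by
    rw [hI, ← integral_finsetSum _ fun p _ => hint p]
    refine integral_mono_of_nonneg (Eventually.of_forall fun U => ?_)
      (integrable_finsetSum _ fun p _ => hint p) (Eventually.of_forall fun U => ?_)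
    · refine Real.iSup_nonneg fun h => ?_
      exact Finset.sum_nonneg fun j _ => Finset.sum_nonneg fun y _ =>
        Finset.sum_nonneg fun a _ => Finset.sum_nonneg fun b _ => by positivity
    · refine Real.iSup_le (fun h => ?_) (Finset.sum_nonneg fun p _ =>
        Real.iSup_nonneg fun h => hcov0 U h.1 p)
      rw [← hpars U h.1]
      exact Finset.sum_le_sum fun p _ => le_ciSup (hbdd U p) h
  calc (1 / (2 * S + 1 : ℝ) ^ 3) *
        ∫ U, (⨆ h : {h : Site 4 (2 * S + 1) → G // ∀ h', coul U h ≤ coul U h'}, Amass U h.1) ∂μ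
      ≤ (1 / (2 * S + 1 : ℝ) ^ 3) * ∑ p, I p :=
        mul_le_mul_of_nonneg_left h2 (by positivity)
    _ ≤ Dmax := h1

end ParsevalCrux

section SubCrux

variable {G : Type*} [Group G] [TopologicalSpace G] [IsTopologicalGroup G] [CompactSpace G]
  [MeasurableSpace G] [BorelSpace G]

/-- **The Coulomb-gauge mass floor** at `(G, r)` — the natural SUFFICIENT condition for the floor
that the crux forces (G3), with no test functions in it: for `β ≥ β₀` there are `a(β) > 0` and
`S₀(β)` such that on all tori `S ≥ S₀`,
`a ≤ L⁻³ · E_μ[ sup_{h ∈ argmin coul(U,·)} Σ_{j,y} ‖A^h_j(y)‖²_F ]`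
(`= 3 ·` the mean squared anti-Hermitian part of the minimal-Coulomb-gauge slice links). Offered
to planners as the layer-2 statement under `BrascampLiebVacuumSC` on the `Dmax` side (the other
side being the relative log-concavity / Brascamp–Lieb content). [folklore] -/
def CoulombGaugeAFloor (r : LatticeRep G) : Prop :=
  ∃ β₀ : ℝ, ∀ β : ℝ, β₀ ≤ β → ∃ a : ℝ, 0 < a ∧ ∃ S₀ : ℕ, ∀ S : ℕ, S₀ ≤ S →
    let fro : Matrix (Fin r.N) (Fin r.N) ℂ → ℝ := fun M => ∑ a, ∑ b, ‖M a b‖ ^ 2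
    let Amass : GaugeConfig 4 (2 * S + 1) G → (Site 4 (2 * S + 1) → G) → ℝ := fun U h =>
      ∑ j : Fin 3, ∑ y : Fin 3 → ZMod (2 * S + 1),
        fro ((1 / 2 : ℂ) • (r.ρ (gaugeTransform h U (Fin.cons (0 : ZMod (2 * S + 1)) y, j.succ)) -
          (r.ρ (gaugeTransform h U (Fin.cons (0 : ZMod (2 * S + 1)) y, j.succ)))ᴴ))
    let μ := wilsonMeasure (d := 4) (L := 2 * S + 1) r.ρ β
    let coul : GaugeConfig 4 (2 * S + 1) G → (Site 4 (2 * S + 1) → G) → ℝ := fun U h =>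
      -∑ e : Edge 4 (2 * S + 1),
        (if e.1 0 = 0 ∧ e.2 ≠ 0 then (r.ρ (gaugeTransform h U e)).trace.re else 0)
    a ≤ (1 / (2 * S + 1 : ℝ) ^ 3) *
      ∫ U, (⨆ h : {h : Site 4 (2 * S + 1) → G // ∀ h', coul U h ≤ coul U h'}, Amass U h.1) ∂μ

/-- **Coulomb-gauge mass floor ⇒ `Dmax` floor** (by `dmax_ge_parseval`): the sub-crux above is
sufficient for the necessary condition of G3. (Integrability of the `Dmax` integrands is supplied
by `integrable_dmaxIntegrand`; here it is passed from the local copy.) [folklore] -/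
theorem dmax_floor_of_coulombGaugeAFloor (r : LatticeRep G) (hA : CoulombGaugeAFloor r) :
    ∃ β₀ : ℝ, ∀ β : ℝ, β₀ ≤ β → ∃ c : ℝ, 0 < c ∧ ∃ S₀ : ℕ, ∀ S : ℕ, S₀ ≤ S →
    let μ := wilsonMeasure (d := 4) (L := 2 * S + 1) r.ρ β
    let fro : Matrix (Fin r.N) (Fin r.N) ℂ → ℝ := fun M => ∑ a, ∑ b, ‖M a b‖ ^ 2
    let coul : GaugeConfig 4 (2 * S + 1) G → (Site 4 (2 * S + 1) → G) → ℝ := fun U h =>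
      -∑ e : Edge 4 (2 * S + 1),
        (if e.1 0 = 0 ∧ e.2 ≠ 0 then (r.ρ (gaugeTransform h U e)).trace.re else 0)
    let cov : GaugeConfig 4 (2 * S + 1) G → (Site 4 (2 * S + 1) → G) →
        (Fin 3 → ZMod (2 * S + 1)) → ℝ := fun U h p =>
      (∑ j : Fin 3, fro (∑ y : Fin 3 → ZMod (2 * S + 1),
        Complex.exp (-(2 * Real.pi * Complex.I *
          (∑ i : Fin 3, ((p i).val : ℂ) * ((y i).val : ℂ)) / (2 * S + 1 : ℂ))) •
        ((1 / 2 : ℂ) • (r.ρ (gaugeTransform h U (Fin.cons (0 : ZMod (2 * S + 1)) y, j.succ)) -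
          (r.ρ (gaugeTransform h U (Fin.cons (0 : ZMod (2 * S + 1)) y, j.succ)))ᴴ)))) /
        ((2 * S + 1 : ℝ) ^ 3)
    let Dmax : ℝ := ⨆ p : Fin 3 → ZMod (2 * S + 1),
      ∫ U, (⨆ h : {h : Site 4 (2 * S + 1) → G // ∀ h', coul U h ≤ coul U h'}, cov U h.1 p) ∂μ
    c ≤ Dmax := by
  obtain ⟨β₀, hβ⟩ := hA
  refine ⟨β₀, fun β hb => ?_⟩
  obtain ⟨a, ha, S₀, hS₀⟩ := hβ β hb
  refine ⟨a, ha, S₀, fun S hS => ?_⟩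
  intro μ fro coul cov Dmax
  have h1 := hS₀ S hS
  have h2 := dmax_ge_parseval r β S (fun p => integrable_dmaxIntegrand r β S p)
  exact h1.trans h2

end SubCrux

end Genuine

/-! ### Near-misses, open regimes, notes for the next seat (docstring record)

* DONE this cycle: `simplyConnectedSpace_su2` (section `SU2`) and `PlaquetteVarianceFloor r` for
  every admissible `(G, r)` (section `FloorProofs`).
* NEXT lever for a disprover: the floor itself. `dmax_floor_of_brascampLiebVacuumSC` reduces ¬crux
  to a statement about the MINIMAL LATTICE COULOMB GAUGE ALONE — `liminf_S sup_p D(p; β, S) = 0` at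
  fixed large `β` for one SC admissible `(G, r)`. Attack ideas: (i) Zwanziger's FMR bounds
  (`CoulombGaugeFPPositivity.lean`, `abs_sum_pairing_le`) give UPPER bounds on low-momentum
  components — check whether they can force `sup_p D(p) → 0` (they cannot at `|p| ≍ 1`: UV modes
  carry `E‖A‖² ≍ dim G/β`); (ii) a lower bound `E[mean_ℓ ‖A^h_ℓ‖²] ≥ a(β)/16 − (near-π leak)`
  would instead PROVE the floor and close this lever for good.
* Mechanisms for `DmaxDegenerate` at weak coupling: NONE. Infrared suppression `D(p → 0) → 0`
  (GZ scenario; Zwanziger 1991: zero-momentum mean field `O(1/L)`) concerns the few smallest of the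
  `(2S+1)³` momenta; `avg_p D(p) = 3·E[mean_ℓ ‖A^h_ℓ‖²_F]` (Parseval, `Σ_p sup_h ≥ sup_h Σ_p`),
  and `mean_ℓ ‖1 − U^h_ℓ‖²_F ≥ (1/16)·mean_p ‖1 − U_p‖²_F` in ANY gauge, `E‖1 − U_p‖² ≥ a(β) > 0`
  uniformly (DLR); the only leak is eigenphases near `π` of minimal-Coulomb-gauge links, which
  maximality makes rare but does not exclude pointwise — this is the prover's floor lemma, not a
  refutation lever.
* Slow modes at SC `G`, fixed `β ≥ β₀(G, r)`, `Var/dir ≫ S³`: none (flux sectors absent; bulk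
  transitions of `β·Re χ_r` at bounded `β`; flat-connection moduli components unprotected; centre
  sectors of spatial Polyakov loops fast; vortex-sheet pairs `e^{−2σS²}`) — concurring with
  ATTACK.md of the crux-attack refuter and `Findings-ideator1.md` S4.
-/

end Summit.QuantumFields.YangMills.Cruxes.BrascampLiebVacuumSC.Disproof

end
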